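import Mathlib
import HarnessLib
import Literature.Barriers.NavierStokesRegularity.TruncatedDyadicBlowup

/-!
# Proof of Tao's Proposition 5.1 (blow-up for the exogenously truncated dyadic model)

Sibling proof file of `Literature/Barriers/NavierStokesRegularity/TruncatedDyadicBlowup.lean`:
it discharges the named fact `TruncatedDyadic.Tao2016_prop51` (T. Tao, JAMS 29 (2016), §5.2
Prop. 5.1, as printed with modes re-indexed by `k = n - n₀`) and hence the barrier catalogue
entry `TruncatedDyadicBlowup` (`TruncatedDyadicBlowup_holds`, at the end of the file). Real
proofs throughout; no new facts.

## The printed proof (Tao 2016, p. 26) and its formalization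

* Steps 1–4 (iterative construction): `t_{n₀} = 0`, `X_{n₀}(0) = 1`, all other modes `0`; on
  `[t_{n₀+k}, t_{n₀+k+1}]` the pair `(X_{n₀+k}, X_{n₀+k+1})` solves the "pump system with
  dissipation" while every other mode decays linearly, and `t_{n₀+k+1}` is a time at which
  `X_{n₀+k+1} = λ^{-δ(k+1)}`. Here: the structure `TruncatedDyadic.StepData` (per-step rescaled
  solutions), the switching times `StepData.t k = ∑_{j<k} Δ_j`, and the modes `StepData.X`
  defined phase by phase (zero / receiving / giving / free decay); `StepData.hasDerivAt_X`
  verifies the truncated ODE off the switching times, `StepData.continuous_X` continuity.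
* The change of variables `x(t) = λ^{δk} X_{n₀+k}(t_{n₀+k} + λ^{-n₀-k+δk} t)` leading to
  `∂ₜx = -εx - xy`, `∂ₜy = -ε'y + x²` with `ε = λ^{-(1-2α)n₀-(1-2α-δ)k}` (and `ε' = λ^{2α} ε`):
  the scales `scaleA`, `scaleC`, `scaleD` and the chain-rule lemmas `StepData.hasDerivAt_give`,
  `StepData.hasDerivAt_recv`.
* "standard perturbation arguments then show that if `n₀` is sufficiently large (which forces `ε`
  to be sufficiently small), [`y = λ^{-δ}`] occurs at some time `t ≤ 2 tanh⁻¹(λ^{-δ})` (say)":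
  `TruncatedDyadic.pumpGate_exists` — Picard–Lindelöf (Mathlib's `IsPicardLindelof`) for the
  vector field truncated to `[-2, 2]²` (globally Lipschitz), Grönwall comparison
  (`dist_le_of_approx_trajectories_ODE`) with the explicit undamped solution `(sech, tanh)` of
  §5.1 (pomp), which keeps the solution in the region where the truncation is inactive, and the
  intermediate value theorem; the horizon used is `T = 2 / (1 - λ^{-δ})` (any bounded horizon
  suffices for the proposition, whose statement does not mention the bound `2 tanh⁻¹(λ^{-δ})`).
* "`t_{n₀+k+1} - t_{n₀+k} ≤ 2 tanh⁻¹(λ^{-δ}) λ^{-n₀-k+δk}`, so `t_n` converges to a finite limit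
  `T_*`": `StepData.summable_Δ` (geometric domination, using `δ < 1`), `StepData.Tstar`,
  `StepData.tendsto_t`; the blow-up `λ^{δ'(n₀+k)} X_{n₀+k}(t_{n₀+k}) = λ^{δ'n₀ + (δ'-δ)k} → ∞`
  is `StepData.blowup`.

* Endpoint and Type I (appendix, not in print; barrier audit 2026-08-14): the printed hypothesis
  `δ < 1 - 2α` is used only through `2α - 1 + δ ≤ 0`, so the construction runs verbatim for
  `0 < δ ≤ 1 - 2α` (`TruncatedDyadic.exists_stepData`, `TruncatedDyadic.Tao2016_prop51_of_le`);
  at the endpoint `δ = 1 - 2α` — the critical decay exponent of the dyadic scaling — the pump-gate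
  energy bound `U² + V² ≤ 1` (`StepData.sq_add_sq_le_one`, `StepData.abs_X_le`) shows that the
  critical weighted amplitude `λ^{(1-2α)(n₀+k)}|X_k(s)|` stays bounded while every higher weight
  blows up: a blow-up at the Type I (scale-invariant) RATE — named statement
  `TruncatedDyadic.Tao2016_prop51_endpoint`, proof `TruncatedDyadic.Tao2016_prop51_typeI`; since the
  rescaled dissipations are constant in `k` at the endpoint, one pump-gate solution serves every
  step (`TruncatedDyadic.exists_stepData_const`) and the witness is then EXACTLY discretely
  self-similar from the second mode on, `X_{k+1}(t_{k+1}+σ) = λ^{-(1-2α)}X_k(t_k+λ^{2α}σ)`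
  (`StepData.dss`, `TruncatedDyadic.Tao2016_prop51_dss`); catalogue facet
  `TruncatedDyadicTypeIBlowup` (structured BARRIER block) with `TruncatedDyadicTypeIBlowup_holds`
  and `.at_two_fifths`.

## References

* T. Tao, *Finite time blowup for an averaged three-dimensional Navier–Stokes equation*, J. Amer.
  Math. Soc. 29 (2016), 601–674; arXiv:1402.0290, §5.1 (pump gate, explicit solution (pomp)),
  §5.2 Prop. 5.1 and its proof (p. 26), §1.1 footnote p. 8 (Type I / Type II). [`Tao2016AveragedNS`]
* L. Escauriaza, G. Seregin, V. Šverák, Russ. Math. Surveys 58 (2003), Thms. 1.3–1.4 (cited in the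
  facet's `evasions_known`). [`EscauriazaSereginSverak2003`]
-/

noncomputable section

open Set Filter Topology Metric

namespace Literature.Barriers.NavierStokesRegularity

namespace TruncatedDyadic

/-! ### The dissipative pump gate (Tao 2016, §5.1–5.2) -/

/-- Truncation of a real number to the interval `[-2, 2]` (used to make the pump-gate vector
field globally Lipschitz; the truncation is inactive along the solutions we construct). [folklore] -/
def clamp2 (w : ℝ) : ℝ := max (-2) (min 2 w)

/-- The truncation `clamp2` is `1`-Lipschitz. [folklore] -/
lemma clamp2_lipschitz : LipschitzWith 1 clamp2 :=
  (LipschitzWith.id.const_min 2).const_max (-2)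

/-- `|clamp2 w| ≤ 2`. [folklore] -/
lemma abs_clamp2_le (w : ℝ) : |clamp2 w| ≤ 2 := by
  unfold clamp2
  rw [abs_le]
  exact ⟨le_max_left _ _, max_le (by norm_num) (min_le_left _ _)⟩

/-- The truncation is the identity on `[-2, 2]`. [folklore] -/
lemma clamp2_eq {w : ℝ} (h : |w| ≤ 2) : clamp2 w = w := by
  rw [abs_le] at h
  unfold clamp2
  rw [min_eq_right h.2, max_eq_right h.1]

/-- `|clamp2 a - clamp2 b| ≤ |a - b|`. [folklore] -/
lemma abs_clamp2_sub_le (a b : ℝ) : |clamp2 a - clamp2 b| ≤ |a - b| := by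
  have := clamp2_lipschitz.dist_le_mul a b
  simpa [Real.dist_eq] using this

/-- The dissipative pump-gate vector field `(u, v) ↦ (-ε u - u v, -ε' v + u²)`
[cite: Tao2016AveragedNS, §5.2, proof of Prop. 5.1 (rescaled system)] -/
def pumpField (ε ε' : ℝ) (p : ℝ × ℝ) : ℝ × ℝ :=
  (-ε * p.1 - p.1 * p.2, -ε' * p.2 + p.1 ^ 2)

/-- The pump-gate field with both arguments truncated to `[-2, 2]`: globally Lipschitz and bounded. [folklore] -/
def pumpFieldC (ε ε' : ℝ) (p : ℝ × ℝ) : ℝ × ℝ :=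
  pumpField ε ε' (clamp2 p.1, clamp2 p.2)

/-- On the box `[-2, 2]²` the truncated field is the pump-gate field. [folklore] -/
lemma pumpFieldC_eq_of_abs_le {ε ε' : ℝ} {p : ℝ × ℝ} (h1 : |p.1| ≤ 2) (h2 : |p.2| ≤ 2) :
    pumpFieldC ε ε' p = pumpField ε ε' p := by
  simp [pumpFieldC, clamp2_eq h1, clamp2_eq h2]

/-- For `|ε|, |ε'| ≤ 1` the truncated pump-gate field is globally `5`-Lipschitz (sup norm on `ℝ × ℝ`). [folklore] -/
lemma lipschitzWith_pumpFieldC {ε ε' : ℝ} (hε : |ε| ≤ 1) (hε' : |ε'| ≤ 1) :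
    LipschitzWith 5 (pumpFieldC ε ε') := by
  apply LipschitzWith.of_dist_le_mul
  intro p q
  set d := dist p q with hd
  have hd1 : |p.1 - q.1| ≤ d := by
    rw [← Real.dist_eq, hd, Prod.dist_eq]; exact le_max_left _ _
  have hd2 : |p.2 - q.2| ≤ d := by
    rw [← Real.dist_eq, hd, Prod.dist_eq]; exact le_max_right _ _
  set u₁ := clamp2 p.1
  set v₁ := clamp2 p.2
  set u₂ := clamp2 q.1
  set v₂ := clamp2 q.2
  have hu : |u₁ - u₂| ≤ d := (abs_clamp2_sub_le _ _).trans hd1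
  have hv : |v₁ - v₂| ≤ d := (abs_clamp2_sub_le _ _).trans hd2
  have hu₁ : |u₁| ≤ 2 := abs_clamp2_le _
  have hu₂ : |u₂| ≤ 2 := abs_clamp2_le _
  have hv₂ : |v₂| ≤ 2 := abs_clamp2_le _
  have hdnn : 0 ≤ d := dist_nonneg
  rw [Prod.dist_eq, Real.dist_eq, Real.dist_eq]
  apply max_le
  · have e : (pumpFieldC ε ε' p).1 - (pumpFieldC ε ε' q).1 =
        -(ε * (u₁ - u₂) + u₁ * (v₁ - v₂) + v₂ * (u₁ - u₂)) := by
      simp only [pumpFieldC, pumpField]; ring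
    rw [e, abs_neg]
    calc |ε * (u₁ - u₂) + u₁ * (v₁ - v₂) + v₂ * (u₁ - u₂)|
        ≤ |ε * (u₁ - u₂)| + |u₁ * (v₁ - v₂)| + |v₂ * (u₁ - u₂)| := abs_add_three _ _ _
      _ = |ε| * |u₁ - u₂| + |u₁| * |v₁ - v₂| + |v₂| * |u₁ - u₂| := by
          simp only [abs_mul]
      _ ≤ 1 * d + 2 * d + 2 * d := by
          gcongr
      _ = (5 : NNReal) * d := by push_cast; ring
  · have e : (pumpFieldC ε ε' p).2 - (pumpFieldC ε ε' q).2 =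
        -(ε' * (v₁ - v₂)) + (u₁ + u₂) * (u₁ - u₂) := by
      simp only [pumpFieldC, pumpField]; ring
    rw [e]
    calc |-(ε' * (v₁ - v₂)) + (u₁ + u₂) * (u₁ - u₂)|
        ≤ |-(ε' * (v₁ - v₂))| + |(u₁ + u₂) * (u₁ - u₂)| := abs_add_le _ _
      _ = |ε'| * |v₁ - v₂| + |u₁ + u₂| * |u₁ - u₂| := by
          simp only [abs_neg, abs_mul]
      _ ≤ |ε'| * |v₁ - v₂| + (|u₁| + |u₂|) * |u₁ - u₂| := by
          gcongr; exact abs_add_le _ _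
      _ ≤ 1 * d + (2 + 2) * d := by
          gcongr
      _ = (5 : NNReal) * d := by push_cast; ring

/-- For `|ε|, |ε'| ≤ 1` the truncated pump-gate field is bounded by `6`. [folklore] -/
lemma norm_pumpFieldC_le {ε ε' : ℝ} (hε : |ε| ≤ 1) (hε' : |ε'| ≤ 1) (p : ℝ × ℝ) :
    ‖pumpFieldC ε ε' p‖ ≤ 6 := by
  set u := clamp2 p.1
  set v := clamp2 p.2
  have hu : |u| ≤ 2 := abs_clamp2_le _
  have hv : |v| ≤ 2 := abs_clamp2_le _
  rw [Prod.norm_def, Real.norm_eq_abs, Real.norm_eq_abs]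
  apply max_le
  · have e : (pumpFieldC ε ε' p).1 = -(ε * u + u * v) := by
      simp only [pumpFieldC, pumpField]; ring
    rw [e, abs_neg]
    calc |ε * u + u * v| ≤ |ε * u| + |u * v| := abs_add_le _ _
      _ = |ε| * |u| + |u| * |v| := by simp only [abs_mul]
      _ ≤ 1 * 2 + 2 * 2 := by gcongr
      _ = 6 := by norm_num
  · have e : (pumpFieldC ε ε' p).2 = -(ε' * v) + u ^ 2 := by
      simp only [pumpFieldC, pumpField]; ring
    rw [e]
    calc |-(ε' * v) + u ^ 2| ≤ |-(ε' * v)| + |u ^ 2| := abs_add_le _ _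
      _ = |ε'| * |v| + |u| ^ 2 := by simp only [abs_neg, abs_mul, abs_pow]
      _ ≤ 1 * 2 + 2 ^ 2 := by gcongr
      _ = 6 := by norm_num

/-- The explicit solution `(sech, tanh)` of the undamped pump gate, (pomp) with `A = α = 1`.
[cite: Tao2016AveragedNS, §5.1 (pomp)] -/
def pumpExplicit (τ : ℝ) : ℝ × ℝ := ((Real.cosh τ)⁻¹, Real.sinh τ / Real.cosh τ)

/-- `(sech, tanh)` solves the undamped pump gate `x' = -xy`, `y' = x²`. [cite: Tao2016AveragedNS, §5.1 (pomp)] -/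
lemma hasDerivAt_pumpExplicit (τ : ℝ) :
    HasDerivAt pumpExplicit (pumpField 0 0 (pumpExplicit τ)) τ := by
  have hc : Real.cosh τ ≠ 0 := (Real.cosh_pos τ).ne'
  have h1 : HasDerivAt (fun s => (Real.cosh s)⁻¹) (-(Real.sinh τ) / (Real.cosh τ) ^ 2) τ :=
    (Real.hasDerivAt_cosh τ).inv hc
  have h2 : HasDerivAt (fun s => Real.sinh s / Real.cosh s)
      ((Real.cosh τ * Real.cosh τ - Real.sinh τ * Real.sinh τ) / (Real.cosh τ) ^ 2) τ :=
    (Real.hasDerivAt_sinh τ).div (Real.hasDerivAt_cosh τ) hc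
  have h : HasDerivAt pumpExplicit (-(Real.sinh τ) / (Real.cosh τ) ^ 2,
      (Real.cosh τ * Real.cosh τ - Real.sinh τ * Real.sinh τ) / (Real.cosh τ) ^ 2) τ :=
    h1.prodMk h2
  convert h using 1
  have hid : Real.cosh τ ^ 2 - Real.sinh τ ^ 2 = 1 := Real.cosh_sq_sub_sinh_sq τ
  simp only [pumpField, pumpExplicit, Prod.mk.injEq]
  constructor
  · field_simp; ring
  · field_simp
    nlinarith [hid]

/-- The explicit solution is continuous. [folklore] -/
lemma continuous_pumpExplicit : Continuous pumpExplicit :=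
  continuous_iff_continuousAt.2 fun τ => (hasDerivAt_pumpExplicit τ).continuousAt

/-- The explicit solution starts at `(1, 0)`. [cite: Tao2016AveragedNS, §5.1 (pomp)] -/
lemma pumpExplicit_zero : pumpExplicit 0 = (1, 0) := by
  simp [pumpExplicit]

/-- `sech τ > 0`. [folklore] -/
lemma pumpExplicit_fst_pos (τ : ℝ) : 0 < (pumpExplicit τ).1 := by
  simp only [pumpExplicit]
  exact inv_pos.2 (Real.cosh_pos τ)

/-- `sech τ ≤ 1`. [folklore] -/
lemma pumpExplicit_fst_le_one (τ : ℝ) : (pumpExplicit τ).1 ≤ 1 := by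
  simp only [pumpExplicit]
  exact inv_le_one_of_one_le₀ (Real.one_le_cosh τ)

/-- `|tanh τ| < 1`. [folklore] -/
lemma abs_pumpExplicit_snd_lt_one (τ : ℝ) : |(pumpExplicit τ).2| < 1 := by
  simp only [pumpExplicit]
  have hc := Real.cosh_pos τ
  have h : |Real.sinh τ| < Real.cosh τ := by
    have h2 : Real.sinh τ ^ 2 < Real.cosh τ ^ 2 := by rw [Real.cosh_sq]; linarith
    exact abs_lt_of_sq_lt_sq h2 hc.le
  rw [abs_div, abs_of_pos hc, div_lt_one hc]
  exact h

/-- `tanh τ ≥ 1 - e^{-τ}`. [folklore] -/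
lemma one_sub_exp_le_pumpExplicit_snd (τ : ℝ) : 1 - Real.exp (-τ) ≤ (pumpExplicit τ).2 := by
  simp only [pumpExplicit]
  have hc := Real.cosh_pos τ
  have h1 := Real.one_le_cosh τ
  have he : Real.cosh τ - Real.sinh τ = Real.exp (-τ) := Real.cosh_sub_sinh τ
  rw [le_div_iff₀ hc]
  have hexp : 0 < Real.exp (-τ) := Real.exp_pos _
  nlinarith

/-- **The dissipative pump gate reaches every level below `1` in bounded time, uniformly for small
dissipation** — the "standard perturbation argument" in the proof of Tao 2016, Prop. 5.1: for
`0 < θ < 1` there are a horizon `T > 0` and a threshold `η > 0` such that for all dissipation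
coefficients `0 ≤ ε, ε' ≤ η` the system `u' = -ε u - u v`, `v' = -ε' v + u²`, `u(0) = 1`,
`v(0) = 0` has a solution on `[0, T]` (extended continuously to `ℝ`) along which `v` takes the
value `θ` at some time `τ₁ ∈ (0, T]`. Proof: Picard–Lindelöf for the truncated field, Grönwall
comparison with the explicit undamped solution `(sech, tanh)`, intermediate value theorem.
[cite: Tao2016AveragedNS, §5.2, proof of Prop. 5.1 (p. 26) and §5.1 (pump), (pomp)] -/
theorem pumpGate_exists {θ : ℝ} (hθ₀ : 0 < θ) (hθ₁ : θ < 1) :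
    ∃ T : ℝ, 0 < T ∧ ∃ η : ℝ, 0 < η ∧ ∀ ε ε' : ℝ, 0 ≤ ε → ε ≤ η → 0 ≤ ε' → ε' ≤ η →
      ∃ (u v : ℝ → ℝ) (τ₁ : ℝ), 0 < τ₁ ∧ τ₁ ≤ T ∧ u 0 = 1 ∧ v 0 = 0 ∧ v τ₁ = θ ∧
        Continuous u ∧ Continuous v ∧
        ∀ τ ∈ Ioo 0 T, HasDerivAt u (-ε * u τ - u τ * v τ) τ ∧
          HasDerivAt v (-ε' * v τ + u τ ^ 2) τ := by
  -- the horizon `T`, chosen so that `tanh T > (1 + θ) / 2`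
  set T : ℝ := 2 / (1 - θ) with hT
  have h1θ : 0 < 1 - θ := by linarith
  have hTpos : 0 < T := div_pos two_pos h1θ
  have htanh : (1 + θ) / 2 < (pumpExplicit T).2 := by
    have hexp : Real.exp (-T) < (1 - θ) / 2 := by
      have h1 : T + 1 < Real.exp T := Real.add_one_lt_exp hTpos.ne'
      rw [Real.exp_neg, inv_lt_comm₀ (Real.exp_pos T) (by positivity)]
      calc ((1 - θ) / 2)⁻¹ = T := by rw [hT, inv_div]
        _ < T + 1 := lt_add_one T
        _ < Real.exp T := h1
    have := one_sub_exp_le_pumpExplicit_snd T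
    linarith
  -- the closeness radius `ρ` and the dissipation threshold `η`
  set ρ : ℝ := (1 - θ) / 4 with hρ
  have hρpos : 0 < ρ := by positivity
  have hρle : ρ ≤ 1 / 4 := by rw [hρ]; linarith
  set η : ℝ := ρ * Real.exp (-(5 * T)) with hη
  have hηpos : 0 < η := mul_pos hρpos (Real.exp_pos _)
  have hηρ : η ≤ ρ := by
    have : Real.exp (-(5 * T)) ≤ 1 := Real.exp_le_one_iff.2 (by linarith)
    rw [hη]; nlinarith
  have hη1 : η ≤ 1 := by linarith
  refine ⟨T, hTpos, η, hηpos, fun ε ε' hε0 hεη hε'0 hε'η => ?_⟩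
  have hεabs : |ε| ≤ 1 := by rw [abs_of_nonneg hε0]; linarith
  have hε'abs : |ε'| ≤ 1 := by rw [abs_of_nonneg hε'0]; linarith
  -- Picard–Lindelöf for the truncated field on `[0, T]`
  set G := pumpFieldC ε ε' with hG
  have hGlip : LipschitzWith 5 G := lipschitzWith_pumpFieldC hεabs hε'abs
  have hGbd : ∀ p, ‖G p‖ ≤ 6 := norm_pumpFieldC_le hεabs hε'abs
  have ht₀ : (0 : ℝ) ∈ Icc 0 T := ⟨le_rfl, hTpos.le⟩
  set a : NNReal := ⟨6 * T + 1, by positivity⟩ with ha_def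
  have ha : (a : ℝ) = 6 * T + 1 := rfl
  have hPL : IsPicardLindelof (fun _ : ℝ => G) (⟨0, ht₀⟩ : Icc 0 T) ((1 : ℝ), (0 : ℝ))
      a 0 6 5 := by
    apply IsPicardLindelof.of_time_independent
    · intro p _; exact_mod_cast hGbd p
    · exact hGlip.lipschitzOnWith
    · rw [ha]
      simp only [NNReal.coe_zero, sub_zero, sub_self, max_eq_left hTpos.le]
      push_cast
      linarith
  obtain ⟨w, hw0, hw⟩ := hPL.exists_eq_forall_mem_Icc_hasDerivWithinAt₀
  replace hw0 : w 0 = (1, 0) := by simpa using hw0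
  have hwcont : ContinuousOn w (Icc 0 T) := fun t ht => (hw t ht).continuousWithinAt
  -- Grönwall comparison with the explicit undamped solution
  have hzG : ∀ t, G (pumpExplicit t) = pumpField ε ε' (pumpExplicit t) := by
    intro t
    apply pumpFieldC_eq_of_abs_le
    · rw [abs_of_pos (pumpExplicit_fst_pos t)]
      linarith [pumpExplicit_fst_le_one t]
    · linarith [abs_pumpExplicit_snd_lt_one t]
  have hdist : ∀ t ∈ Icc 0 T, dist (w t) (pumpExplicit t) ≤ ρ := by
    intro t ht
    have key := dist_le_of_approx_trajectories_ODE (v := fun _ => G) (K := 5) (f := w)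
      (g := pumpExplicit) (f' := fun t => G (w t)) (g' := fun t => pumpField 0 0 (pumpExplicit t))
      (a := 0) (b := T) (εf := 0) (εg := η) (δ := 0) (fun _ => hGlip) hwcont
      (fun s hs => (hw s (Ico_subset_Icc_self hs)).mono_of_mem_nhdsWithin
        (Icc_mem_nhdsGE_of_mem hs))
      (fun s _ => by simp)
      continuous_pumpExplicit.continuousOn
      (fun s _ => (hasDerivAt_pumpExplicit s).hasDerivWithinAt)
      ?_ (by rw [hw0, pumpExplicit_zero, dist_self]) t ht
    · have hK : ((5 : NNReal) : ℝ) ≠ 0 := by norm_num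
      rw [gronwallBound_of_K_ne_0 hK] at key
      have h5 : ((5 : NNReal) : ℝ) = 5 := by norm_num
      simp only [h5, zero_mul, zero_add, sub_zero] at key
      have hexp : Real.exp (5 * t) ≤ Real.exp (5 * T) := Real.exp_le_exp.2 (by linarith [ht.2])
      have hexp' : η * Real.exp (5 * T) = ρ := by
        rw [hη, mul_assoc, ← Real.exp_add]; norm_num
      have h1 : η / 5 * (Real.exp (5 * t) - 1) ≤ η / 5 * Real.exp (5 * T) := by
        have := Real.exp_pos (5 * t)
        have : 0 ≤ η / 5 := by positivity
        nlinarith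
      calc dist (w t) (pumpExplicit t) ≤ η / 5 * (Real.exp (5 * t) - 1) := key
        _ ≤ η / 5 * Real.exp (5 * T) := h1
        _ = ρ / 5 := by rw [← hexp']; ring
        _ ≤ ρ := by linarith
    · intro s _
      rw [hzG s, Prod.dist_eq, Real.dist_eq, Real.dist_eq]
      have e1 : (pumpField 0 0 (pumpExplicit s)).1 - (pumpField ε ε' (pumpExplicit s)).1 =
          ε * (pumpExplicit s).1 := by simp only [pumpField]; ring
      have e2 : (pumpField 0 0 (pumpExplicit s)).2 - (pumpField ε ε' (pumpExplicit s)).2 =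
          ε' * (pumpExplicit s).2 := by simp only [pumpField]; ring
      rw [e1, e2, abs_mul, abs_mul, abs_of_nonneg hε0, abs_of_nonneg hε'0]
      apply max_le
      · rw [abs_of_pos (pumpExplicit_fst_pos s)]
        calc ε * (pumpExplicit s).1 ≤ ε * 1 := by gcongr; exact pumpExplicit_fst_le_one s
          _ ≤ η := by linarith
      · calc ε' * |(pumpExplicit s).2| ≤ ε' * 1 := by
              gcongr; exact (abs_pumpExplicit_snd_lt_one s).le
          _ ≤ η := by linarith
  -- hence the truncation is inactive along `w`, which therefore solves the true system
  have habs : ∀ t ∈ Icc 0 T, |(w t).1| ≤ 2 ∧ |(w t).2| ≤ 2 := by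
    intro t ht
    have hd := hdist t ht
    rw [Prod.dist_eq, Real.dist_eq, Real.dist_eq] at hd
    have hd1 := (le_max_left _ _).trans hd
    have hd2 := (le_max_right _ _).trans hd
    have hz1 := pumpExplicit_fst_le_one t
    have hz1' := pumpExplicit_fst_pos t
    have hz2 := abs_pumpExplicit_snd_lt_one t
    constructor
    · have := abs_sub_abs_le_abs_sub (w t).1 (pumpExplicit t).1
      rw [abs_of_pos hz1'] at this
      linarith
    · have := abs_sub_abs_le_abs_sub (w t).2 (pumpExplicit t).2
      linarith
  have hwder : ∀ τ ∈ Ioo 0 T, HasDerivAt w (pumpField ε ε' (w τ)) τ := by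
    intro τ hτ
    have hτ' : τ ∈ Icc 0 T := Ioo_subset_Icc_self hτ
    have h := (hw τ hτ').hasDerivAt (Icc_mem_nhds hτ.1 hτ.2)
    rwa [show G (w τ) = pumpField ε ε' (w τ) from
      pumpFieldC_eq_of_abs_le (habs τ hτ').1 (habs τ hτ').2] at h
  -- continuous extension to `ℝ`
  set W : ℝ → ℝ × ℝ := fun t => w (max 0 (min t T)) with hW
  have hWmem : ∀ t, max 0 (min t T) ∈ Icc 0 T := fun t =>
    ⟨le_max_left _ _, max_le hTpos.le (min_le_right _ _)⟩
  have hWcont : Continuous W :=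
    hwcont.comp_continuous (continuous_const.max (continuous_id.min continuous_const)) hWmem
  have hWeq : ∀ t ∈ Icc 0 T, W t = w t := by
    intro t ht
    simp only [hW, min_eq_left ht.2, max_eq_right ht.1]
  have hWder : ∀ τ ∈ Ioo 0 T, HasDerivAt W (pumpField ε ε' (W τ)) τ := by
    intro τ hτ
    rw [hWeq τ (Ioo_subset_Icc_self hτ)]
    refine (hwder τ hτ).congr_of_eventuallyEq ?_
    filter_upwards [Ioo_mem_nhds hτ.1 hτ.2] with s hs
    exact hWeq s (Ioo_subset_Icc_self hs)
  -- the level `θ` is reached (intermediate value theorem)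
  have hvT : θ ≤ (W T).2 := by
    rw [hWeq T ⟨hTpos.le, le_rfl⟩]
    have hd := hdist T ⟨hTpos.le, le_rfl⟩
    rw [Prod.dist_eq, Real.dist_eq, Real.dist_eq] at hd
    have hd2 := (le_max_right _ _).trans hd
    rw [abs_le] at hd2
    linarith
  have hv0 : (W 0).2 = 0 := by
    rw [hWeq 0 ht₀, hw0]
  have hu0 : (W 0).1 = 1 := by
    rw [hWeq 0 ht₀, hw0]
  have hvcont : Continuous fun t => (W t).2 := continuous_snd.comp hWcont
  obtain ⟨τ₁, hτ₁, hvτ₁⟩ : ∃ τ₁ ∈ Icc 0 T, (W τ₁).2 = θ := by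
    have := intermediate_value_Icc hTpos.le hvcont.continuousOn
    exact this ⟨by rw [hv0]; exact hθ₀.le, hvT⟩
  have hτ₁pos : 0 < τ₁ := by
    rcases hτ₁.1.eq_or_lt with h | h
    · exfalso
      rw [← h, hv0] at hvτ₁
      exact hθ₀.ne hvτ₁
    · exact h
  refine ⟨fun t => (W t).1, fun t => (W t).2, τ₁, hτ₁pos, hτ₁.2, hu0, hv0, hvτ₁,
    continuous_fst.comp hWcont, hvcont, fun τ hτ => ⟨?_, ?_⟩⟩
  · have := (hasFDerivAt_fst (𝕜 := ℝ) (E := ℝ) (F := ℝ)).comp_hasDerivAt τ (hWder τ hτ)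
    simpa [pumpField, Function.comp_def] using this
  · have := (hasFDerivAt_snd (𝕜 := ℝ) (E := ℝ) (F := ℝ)).comp_hasDerivAt τ (hWder τ hτ)
    simpa [pumpField, Function.comp_def] using this

/-! ### Scales of the iterative construction -/

/-- Amplitude `A_k = λ^{-δk}` of the `k`-th mode at its switching time
(`X_{n₀+k}(t_{n₀+k}) = λ^{-δk}`). [cite: Tao2016AveragedNS, §5.2 Prop. 5.1] -/
def scaleA (lam δ : ℝ) (k : ℕ) : ℝ := lam ^ (-(δ * k))

/-- Time scale `c_k = λ^{n₀+k} A_k` of the `k`-th transfer (the change of variables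
`t ↦ t_{n₀+k} + λ^{-n₀-k+δk} t` in the proof of Prop. 5.1). [cite: Tao2016AveragedNS, §5.2, proof of Prop. 5.1] -/
def scaleC (lam δ : ℝ) (n₀ : ℕ) (k : ℕ) : ℝ := lam ^ ((n₀ + k : ℕ) : ℝ) * scaleA lam δ k

/-- Dissipation coefficient `d_k = λ^{2(n₀+k)α}` of the `k`-th mode. [cite: Tao2016AveragedNS, §5.2 Prop. 5.1] -/
def scaleD (lam α : ℝ) (n₀ : ℕ) (k : ℕ) : ℝ := lam ^ (2 * ((n₀ + k : ℕ) : ℝ) * α)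

section scales

variable {lam α δ : ℝ} {n₀ : ℕ}

/-- `A_k > 0`. [folklore] -/
lemma scaleA_pos (hlam : 1 < lam) (k : ℕ) : 0 < scaleA lam δ k :=
  Real.rpow_pos_of_pos (by linarith) _

/-- `c_k > 0`. [folklore] -/
lemma scaleC_pos (hlam : 1 < lam) (k : ℕ) : 0 < scaleC lam δ n₀ k :=
  mul_pos (Real.rpow_pos_of_pos (by linarith) _) (scaleA_pos hlam k)

/-- `d_k > 0`. [folklore] -/
lemma scaleD_pos (hlam : 1 < lam) (k : ℕ) : 0 < scaleD lam α n₀ k :=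
  Real.rpow_pos_of_pos (by linarith) _

/-- `A_0 = 1` (`X_{n₀}(0) = 1`). [cite: Tao2016AveragedNS, §5.2, proof of Prop. 5.1, Step 1] -/
lemma scaleA_zero : scaleA lam δ 0 = 1 := by simp [scaleA]

/-- `A_{k+1} = A_k λ^{-δ}`. [folklore] -/
lemma scaleA_succ (hlam : 1 < lam) (k : ℕ) :
    scaleA lam δ (k + 1) = scaleA lam δ k * lam ^ (-δ) := by
  simp only [scaleA]
  rw [← Real.rpow_add (by linarith)]
  congr 1; push_cast; ring

/-- `1 / c_k = λ^{-n₀} (λ^{-(1-δ)})^k`. [folklore] -/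
lemma inv_scaleC (hlam : 1 < lam) (k : ℕ) :
    (scaleC lam δ n₀ k)⁻¹ = lam ^ (-(n₀ : ℝ)) * (lam ^ (-(1 - δ))) ^ k := by
  have h0 : (0 : ℝ) < lam := by linarith
  simp only [scaleC, scaleA]
  rw [← Real.rpow_natCast, ← Real.rpow_mul h0.le, ← Real.rpow_add h0, ← Real.rpow_add h0,
    ← Real.rpow_neg h0.le]
  congr 1; push_cast; ring

end scales

/-! ### The iterative construction -/

/-- The data of the iterative construction in the proof of Prop. 5.1 (modes re-indexed by
`k = n - n₀`): a common horizon `T` for the rescaled transfers and, for every step `k`, the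
rescaled dissipative pump-gate solution `(U k, V k)` (dissipations `d_k / c_k`, `d_{k+1} / c_k`,
`U k 0 = 1`, `V k 0 = 0`) together with a rescaled time `τ k ∈ (0, T]` at which `V k` reaches the
level `λ^{-δ}`. [cite: Tao2016AveragedNS, §5.2, proof of Prop. 5.1, Steps 1–4] -/
structure StepData (lam α δ : ℝ) (n₀ : ℕ) where
  /-- common horizon of the rescaled transfers -/
  T : ℝ
  /-- rescaled giving mode of step `k` -/
  U : ℕ → ℝ → ℝ
  /-- rescaled receiving mode of step `k` -/
  V : ℕ → ℝ → ℝ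
  /-- rescaled duration of step `k` -/
  τ : ℕ → ℝ
  one_lt : 1 < lam
  δ_lt_one : δ < 1
  τ_pos : ∀ k, 0 < τ k
  τ_le : ∀ k, τ k ≤ T
  U_zero : ∀ k, U k 0 = 1
  V_zero : ∀ k, V k 0 = 0
  V_τ : ∀ k, V k (τ k) = lam ^ (-δ)
  U_cont : ∀ k, Continuous (U k)
  V_cont : ∀ k, Continuous (V k)
  ode : ∀ k, ∀ s ∈ Ioo 0 T,
    HasDerivAt (U k) (-(scaleD lam α n₀ k / scaleC lam δ n₀ k) * U k s - U k s * V k s) s ∧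
    HasDerivAt (V k) (-(scaleD lam α n₀ (k + 1) / scaleC lam δ n₀ k) * V k s + U k s ^ 2) s

namespace StepData

variable {lam α δ : ℝ} {n₀ : ℕ} (D : StepData lam α δ n₀)

/-- `λ > 0`. [folklore] -/
lemma lam_pos (D : StepData lam α δ n₀) : 0 < lam := by linarith [D.one_lt]

/-- Duration `t_{k+1} - t_k = τ_k / c_k` of the `k`-th transfer. [cite: Tao2016AveragedNS, §5.2, proof of Prop. 5.1] -/
def Δ (k : ℕ) : ℝ := D.τ k / scaleC lam δ n₀ k

/-- Each transfer takes positive time. [folklore] -/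
lemma Δ_pos (k : ℕ) : 0 < D.Δ k := div_pos (D.τ_pos k) (scaleC_pos D.one_lt k)

/-- The switching times `t_k = ∑_{j<k} Δ_j` (so `t_0 = 0`). [cite: Tao2016AveragedNS, §5.2 Prop. 5.1] -/
def t (k : ℕ) : ℝ := ∑ j ∈ Finset.range k, D.Δ j

/-- `t_0 = 0` (printed: `t_{n₀} = 0`). [cite: Tao2016AveragedNS, §5.2 Prop. 5.1] -/
lemma t_zero : D.t 0 = 0 := by simp [t]

/-- `t_{k+1} = t_k + Δ_k`. [folklore] -/
lemma t_succ (k : ℕ) : D.t (k + 1) = D.t k + D.Δ k := Finset.sum_range_succ _ _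

/-- `t_k < t_{k+1}`. [cite: Tao2016AveragedNS, §5.2 Prop. 5.1] -/
lemma t_lt_succ (k : ℕ) : D.t k < D.t (k + 1) := by
  rw [t_succ]; linarith [D.Δ_pos k]

/-- The switching times increase strictly. [cite: Tao2016AveragedNS, §5.2 Prop. 5.1] -/
lemma t_strictMono : StrictMono D.t := strictMono_nat_of_lt_succ D.t_lt_succ

/-- `t_k ≥ 0`. [folklore] -/
lemma t_nonneg (k : ℕ) : 0 ≤ D.t k := Finset.sum_nonneg fun j _ => (D.Δ_pos j).le

/-- `c_k (t_{k+1} - t_k) = τ_k`: undoing the time rescaling. [cite: Tao2016AveragedNS, §5.2, proof of Prop. 5.1] -/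
lemma c_mul_sub (k : ℕ) : scaleC lam δ n₀ k * (D.t (k + 1) - D.t k) = D.τ k := by
  rw [t_succ, Δ]
  field_simp [(scaleC_pos D.one_lt k (δ := δ) (n₀ := n₀)).ne']
  ring

/-- `Δ_k ≤ T λ^{-n₀} (λ^{-(1-δ)})^k` (printed: `t_{n₀+k+1} - t_{n₀+k} ≤ 2 tanh⁻¹(λ^{-δ}) λ^{-n₀-k+δk}`). [cite: Tao2016AveragedNS, §5.2, proof of Prop. 5.1] -/
lemma Δ_le (k : ℕ) : D.Δ k ≤ D.T * (lam ^ (-(n₀ : ℝ)) * (lam ^ (-(1 - δ))) ^ k) := by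
  rw [Δ, div_eq_mul_inv, inv_scaleC D.one_lt]
  have : 0 ≤ lam ^ (-(n₀ : ℝ)) * (lam ^ (-(1 - δ))) ^ k :=
    mul_nonneg (Real.rpow_pos_of_pos D.lam_pos _).le (pow_nonneg (Real.rpow_pos_of_pos D.lam_pos _).le _)
  exact mul_le_mul_of_nonneg_right (D.τ_le k) this

/-- The durations are summable (`δ < 1`). [cite: Tao2016AveragedNS, §5.2, proof of Prop. 5.1] -/
lemma summable_Δ : Summable D.Δ := by
  have hr0 : 0 ≤ lam ^ (-(1 - δ)) := (Real.rpow_pos_of_pos D.lam_pos _).le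
  have hr1 : lam ^ (-(1 - δ)) < 1 :=
    Real.rpow_lt_one_of_one_lt_of_neg D.one_lt (by linarith [D.δ_lt_one])
  refine Summable.of_nonneg_of_le (fun k => (D.Δ_pos k).le) D.Δ_le ?_
  exact ((summable_geometric_of_lt_one hr0 hr1).mul_left _).mul_left _

/-- The blow-up time `T_* = ∑_k Δ_k = lim t_k`. [cite: Tao2016AveragedNS, §5.2 Prop. 5.1] -/
def Tstar : ℝ := ∑' k, D.Δ k

/-- `∑ Δ_k = T_*`. [folklore] -/
lemma hasSum_Δ : HasSum D.Δ D.Tstar := D.summable_Δ.hasSum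

/-- `t_k → T_*` ("`t_n` converges to a finite limit `T_*`"). [cite: Tao2016AveragedNS, §5.2, proof of Prop. 5.1] -/
lemma tendsto_t : Tendsto D.t atTop (𝓝 D.Tstar) := D.hasSum_Δ.tendsto_sum_nat

/-- `t_k ≤ T_*`. [folklore] -/
lemma t_le_Tstar (k : ℕ) : D.t k ≤ D.Tstar :=
  sum_le_hasSum (Finset.range k) (fun j _ => (D.Δ_pos j).le) D.hasSum_Δ

/-- `t_k < T_*`. [folklore] -/
lemma t_lt_Tstar (k : ℕ) : D.t k < D.Tstar := (D.t_lt_succ k).trans_le (D.t_le_Tstar (k + 1))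

/-- `T_* > 0`. [folklore] -/
lemma Tstar_pos : 0 < D.Tstar := D.t_zero ▸ D.t_lt_Tstar 0

/-- A non-switching time in `[0, T_*)` lies in some transfer interval. [folklore] -/
lemma exists_mem_Ioo {s : ℝ} (hs0 : 0 ≤ s) (hs : s < D.Tstar) (hns : s ∉ range D.t) :
    ∃ j, s ∈ Ioo (D.t j) (D.t (j + 1)) := by
  classical
  have hex : ∃ m, s < D.t m := ((tendsto_order.1 D.tendsto_t).1 s hs).exists
  have hm0 : Nat.find hex ≠ 0 := by
    intro h
    have := Nat.find_spec hex
    rw [h, t_zero] at this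
    linarith
  obtain ⟨j, hj⟩ : ∃ j, Nat.find hex = j + 1 := Nat.exists_eq_succ_of_ne_zero hm0
  have hm : s < D.t (j + 1) := hj ▸ Nat.find_spec hex
  have hj' : ¬ s < D.t j := Nat.find_min hex (by rw [hj]; exact Nat.lt_succ_self j)
  refine ⟨j, ?_, hm⟩
  rcases (not_lt.1 hj').eq_or_lt with h | h
  · exact absurd ⟨j, h⟩ hns
  · exact h

/-- The transfer intervals are pairwise disjoint. [folklore] -/
lemma eq_of_mem_Ioo {s : ℝ} {i j : ℕ} (hi : s ∈ Ioo (D.t i) (D.t (i + 1)))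
    (hj : s ∈ Ioo (D.t j) (D.t (j + 1))) : i = j := by
  by_contra h
  rcases Nat.lt_or_gt_of_ne h with h | h
  · have : D.t (i + 1) ≤ D.t j := D.t_strictMono.monotone h
    linarith [hi.2, hj.1]
  · have : D.t (j + 1) ≤ D.t i := D.t_strictMono.monotone h
    linarith [hi.1, hj.2]

/-- The indicator `1_{(t_i, t_{i+1})}` at a time of the `j`-th transfer interval. [folklore] -/
lemma indicator_Ioo {s : ℝ} {j : ℕ} (hs : s ∈ Ioo (D.t j) (D.t (j + 1))) (i : ℕ) :
    (Ioo (D.t i) (D.t (i + 1))).indicator (fun _ => (1 : ℝ)) s = if i = j then 1 else 0 := by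
  split_ifs with h
  · subst h; exact Set.indicator_of_mem hs _
  · exact Set.indicator_of_notMem (fun h' => h (D.eq_of_mem_Ioo h' hs)) _

/-- The indicator `1_{(t_{k-1}, t_k)}` (convention `t_{-1} = 0`) at a time of the `j`-th transfer interval. [folklore] -/
lemma indicator_prev {s : ℝ} {j : ℕ} (hs : s ∈ Ioo (D.t j) (D.t (j + 1))) (k : ℕ) :
    (Ioo (prevTime D.t k) (D.t k)).indicator (fun _ => (1 : ℝ)) s =
      if k = j + 1 then 1 else 0 := by
  cases k with
  | zero => simp [prevTime, t_zero]
  | succ m =>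
    simp only [prevTime, Nat.succ_ne_zero, if_false, Nat.add_sub_cancel, D.indicator_Ioo hs m,
      Nat.succ_inj]

/-! #### The phases of a mode -/

/-- Receiving phase of mode `k+1` on `[t_k, t_{k+1}]`: `A_k V_k(c_k (s - t_k))`. [cite: Tao2016AveragedNS, §5.2, proof of Prop. 5.1, Step 2] -/
def recv (k : ℕ) (s : ℝ) : ℝ := scaleA lam δ k * D.V k (scaleC lam δ n₀ k * (s - D.t k))

/-- Giving phase of mode `k` on `[t_k, t_{k+1}]`: `A_k U_k(c_k (s - t_k))`. [cite: Tao2016AveragedNS, §5.2, proof of Prop. 5.1, Step 2] -/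
def give (k : ℕ) (s : ℝ) : ℝ := scaleA lam δ k * D.U k (scaleC lam δ n₀ k * (s - D.t k))

/-- Free decay `X_n' = -λ^{2nα} X_n` of mode `k` after `t_{k+1}`. [cite: Tao2016AveragedNS, §5.2, proof of Prop. 5.1, Step 3] -/
def decay (k : ℕ) (s : ℝ) : ℝ :=
  scaleA lam δ k * D.U k (D.τ k) * Real.exp (-(scaleD lam α n₀ k * (s - D.t (k + 1))))

/-- Mode `k` up to its own switching time `t_k`: identically `1` for `k = 0` (only the value at
`t_0 = 0` matters), and for `k + 1`: zero up to `t_k`, then receiving. [cite: Tao2016AveragedNS, §5.2, proof of Prop. 5.1, Steps 1–2] -/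
def pre : ℕ → ℝ → ℝ
  | 0, _ => 1
  | k + 1, s => if s ≤ D.t k then 0 else D.recv k s

/-- The mode `X_{n₀+k}` of the constructed solution, assembled phase by phase. [cite: Tao2016AveragedNS, §5.2, proof of Prop. 5.1, Steps 1–4] -/
def X (k : ℕ) (s : ℝ) : ℝ :=
  if s ≤ D.t k then D.pre k s else if s ≤ D.t (k + 1) then D.give k s else D.decay k s

/-- The receiving phase is continuous. [folklore] -/
lemma continuous_recv (k : ℕ) : Continuous (D.recv k) :=
  continuous_const.mul ((D.V_cont k).comp (continuous_const.mul (continuous_id.sub continuous_const)))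

/-- The giving phase is continuous. [folklore] -/
lemma continuous_give (k : ℕ) : Continuous (D.give k) :=
  continuous_const.mul ((D.U_cont k).comp (continuous_const.mul (continuous_id.sub continuous_const)))

/-- The decay phase is continuous. [folklore] -/
lemma continuous_decay (k : ℕ) : Continuous (D.decay k) :=
  continuous_const.mul (Real.continuous_exp.comp
    (continuous_const.mul (continuous_id.sub continuous_const)).neg)

/-- The receiving phase starts from `0`. [folklore] -/
lemma recv_t (k : ℕ) : D.recv k (D.t k) = 0 := by simp [recv, D.V_zero]

/-- The giving phase starts from `A_k`. [folklore] -/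
lemma give_t (k : ℕ) : D.give k (D.t k) = scaleA lam δ k := by simp [give, D.U_zero]

/-- The receiving phase ends at `A_{k+1} = λ^{-δ(k+1)}` (the defining property of `t_{k+1}`). [cite: Tao2016AveragedNS, §5.2, proof of Prop. 5.1, Step 2] -/
lemma recv_t_succ (k : ℕ) : D.recv k (D.t (k + 1)) = scaleA lam δ (k + 1) := by
  rw [recv, c_mul_sub, D.V_τ, scaleA_succ D.one_lt]

/-- Value of the giving phase at `t_{k+1}`. [folklore] -/
lemma give_t_succ (k : ℕ) : D.give k (D.t (k + 1)) = scaleA lam δ k * D.U k (D.τ k) := by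
  rw [give, c_mul_sub]

/-- The decay phase starts where the giving phase ends. [folklore] -/
lemma decay_t_succ (k : ℕ) : D.decay k (D.t (k + 1)) = scaleA lam δ k * D.U k (D.τ k) := by
  simp [decay]

/-- The `pre` phase is continuous. [folklore] -/
lemma continuous_pre : ∀ k, Continuous (D.pre k)
  | 0 => continuous_const
  | k + 1 => by
    refine Continuous.if_le continuous_const (D.continuous_recv k) continuous_id
      continuous_const ?_
    rintro s rfl
    exact (D.recv_t k).symm

/-- The `pre` phase ends at `A_k`. [folklore] -/
lemma pre_t : ∀ k, D.pre k (D.t k) = scaleA lam δ k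
  | 0 => by simp [pre, scaleA_zero]
  | k + 1 => by
    show (if D.t (k + 1) ≤ D.t k then 0 else D.recv k (D.t (k + 1))) = _
    rw [if_neg (not_le.2 (D.t_lt_succ k)), recv_t_succ]

/-- The constructed modes are continuous ("continuous, piecewise smooth functions"). [cite: Tao2016AveragedNS, §5.2 Prop. 5.1] -/
lemma continuous_X (k : ℕ) : Continuous (D.X k) := by
  refine Continuous.if_le (D.continuous_pre k) ?_ continuous_id continuous_const ?_
  · refine Continuous.if_le (D.continuous_give k) (D.continuous_decay k) continuous_id
      continuous_const ?_
    rintro s rfl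
    rw [give_t_succ, decay_t_succ]
  · rintro s rfl
    rw [pre_t, if_pos (D.t_lt_succ k).le, give_t]

/-- `X_{n₀+k}(t_{n₀+k}) = λ^{-δk}`. [cite: Tao2016AveragedNS, §5.2 Prop. 5.1] -/
lemma X_t (k : ℕ) : D.X k (D.t k) = scaleA lam δ k := by
  simp only [X, le_refl, if_true, pre_t]

/-- `X_{n₀+k+1}(s) = 0` for `s ≤ t_{n₀+k}`. [cite: Tao2016AveragedNS, §5.2 Prop. 5.1] -/
lemma X_succ_of_le {k : ℕ} {s : ℝ} (hs : s ≤ D.t k) : D.X (k + 1) s = 0 := by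
  simp only [X, pre]
  rw [if_pos (hs.trans (D.t_lt_succ k).le), if_pos hs]

/-- On `(t_k, t_{k+1}]` mode `k+1` is in its receiving phase. [folklore] -/
lemma X_succ_of_mem {k : ℕ} {s : ℝ} (hs : s ∈ Ioc (D.t k) (D.t (k + 1))) :
    D.X (k + 1) s = D.recv k s := by
  simp only [X, pre]
  rw [if_pos hs.2, if_neg (not_le.2 hs.1)]

/-- On `(t_k, t_{k+1}]` mode `k` is in its giving phase. [folklore] -/
lemma X_of_mem {k : ℕ} {s : ℝ} (hs : s ∈ Ioc (D.t k) (D.t (k + 1))) : D.X k s = D.give k s := by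
  simp only [X]
  rw [if_neg (not_le.2 hs.1), if_pos hs.2]

/-- After `t_{k+1}` mode `k` decays freely. [folklore] -/
lemma X_of_lt {k : ℕ} {s : ℝ} (hs : D.t (k + 1) < s) : D.X k s = D.decay k s := by
  simp only [X]
  rw [if_neg (not_le.2 ((D.t_lt_succ k).trans hs)), if_neg (not_le.2 hs)]

/-! #### Derivatives of the phases -/

/-- The rescaled time of a point of the `k`-th transfer interval lies in `(0, T)`. [folklore] -/
lemma mem_Ioo_rescaled {k : ℕ} {s : ℝ} (hs : s ∈ Ioo (D.t k) (D.t (k + 1))) :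
    scaleC lam δ n₀ k * (s - D.t k) ∈ Ioo 0 D.T := by
  have hc := scaleC_pos D.one_lt k (δ := δ) (n₀ := n₀)
  constructor
  · exact mul_pos hc (by linarith [hs.1])
  · calc scaleC lam δ n₀ k * (s - D.t k) < scaleC lam δ n₀ k * (D.t (k + 1) - D.t k) := by
          gcongr; exact hs.2
      _ = D.τ k := D.c_mul_sub k
      _ ≤ D.T := D.τ_le k

/-- Derivative of an affine reparametrization. [folklore] -/
lemma hasDerivAt_affine (c t₀ s : ℝ) : HasDerivAt (fun s => c * (s - t₀)) c s := by
  simpa using ((hasDerivAt_id s).sub_const t₀).const_mul c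

/-- The giving phase solves `X_n' = -λ^{2nα} X_n - λⁿ X_n X_{n+1}` (undoing the rescaling). [cite: Tao2016AveragedNS, §5.2, proof of Prop. 5.1, Step 2] -/
lemma hasDerivAt_give {k : ℕ} {s : ℝ} (hs : s ∈ Ioo (D.t k) (D.t (k + 1))) :
    HasDerivAt (D.give k) (-scaleD lam α n₀ k * D.give k s -
      lam ^ ((n₀ + k : ℕ) : ℝ) * D.give k s * D.recv k s) s := by
  have hc := scaleC_pos D.one_lt k (δ := δ) (n₀ := n₀)
  have hU := (D.ode k _ (D.mem_Ioo_rescaled hs)).1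
  have h : HasDerivAt (D.give k) (scaleA lam δ k *
      ((-(scaleD lam α n₀ k / scaleC lam δ n₀ k) * D.U k (scaleC lam δ n₀ k * (s - D.t k)) -
        D.U k (scaleC lam δ n₀ k * (s - D.t k)) * D.V k (scaleC lam δ n₀ k * (s - D.t k))) *
        scaleC lam δ n₀ k)) s :=
    (hU.comp s (hasDerivAt_affine _ _ s)).const_mul _
  convert h using 1
  have hA : scaleA lam δ k ≠ 0 := (scaleA_pos D.one_lt k).ne'
  have hL : lam ^ ((n₀ + k : ℕ) : ℝ) ≠ 0 := (Real.rpow_pos_of_pos D.lam_pos _).ne'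
  simp only [give, recv, scaleC]
  field_simp

/-- The receiving phase solves `X_{n+1}' = -λ^{2(n+1)α} X_{n+1} + λⁿ X_n²` (undoing the rescaling). [cite: Tao2016AveragedNS, §5.2, proof of Prop. 5.1, Step 2] -/
lemma hasDerivAt_recv {k : ℕ} {s : ℝ} (hs : s ∈ Ioo (D.t k) (D.t (k + 1))) :
    HasDerivAt (D.recv k) (-scaleD lam α n₀ (k + 1) * D.recv k s +
      lam ^ ((n₀ + k : ℕ) : ℝ) * D.give k s ^ 2) s := by
  have hc := scaleC_pos D.one_lt k (δ := δ) (n₀ := n₀)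
  have hV := (D.ode k _ (D.mem_Ioo_rescaled hs)).2
  have h : HasDerivAt (D.recv k) (scaleA lam δ k *
      ((-(scaleD lam α n₀ (k + 1) / scaleC lam δ n₀ k) * D.V k (scaleC lam δ n₀ k * (s - D.t k)) +
        D.U k (scaleC lam δ n₀ k * (s - D.t k)) ^ 2) * scaleC lam δ n₀ k)) s :=
    (hV.comp s (hasDerivAt_affine _ _ s)).const_mul _
  convert h using 1
  have hA : scaleA lam δ k ≠ 0 := (scaleA_pos D.one_lt k).ne'
  have hL : lam ^ ((n₀ + k : ℕ) : ℝ) ≠ 0 := (Real.rpow_pos_of_pos D.lam_pos _).ne'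
  simp only [give, recv, scaleC]
  field_simp

/-- The decay phase solves `X_n' = -λ^{2nα} X_n`. [cite: Tao2016AveragedNS, §5.2, proof of Prop. 5.1, Step 3] -/
lemma hasDerivAt_decay (k : ℕ) (s : ℝ) :
    HasDerivAt (D.decay k) (-scaleD lam α n₀ k * D.decay k s) s := by
  have h : HasDerivAt (D.decay k) (scaleA lam δ k * D.U k (D.τ k) *
      (Real.exp (-(scaleD lam α n₀ k * (s - D.t (k + 1)))) * -scaleD lam α n₀ k)) s :=
    ((hasDerivAt_affine (scaleD lam α n₀ k) (D.t (k + 1)) s).neg.exp).const_mul _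
  convert h using 1
  simp only [decay]
  ring

/-! #### The truncated ODE -/

/-- The constructed modes solve the truncated dyadic system off the switching times. [cite: Tao2016AveragedNS, §5.2 Prop. 5.1] -/
theorem hasDerivAt_X (k : ℕ) {s : ℝ} (hs0 : 0 ≤ s) (hs : s < D.Tstar) (hns : s ∉ range D.t) :
    HasDerivAt (D.X k) (truncRHS lam α n₀ D.t D.X k s) s := by
  obtain ⟨j, hj⟩ := D.exists_mem_Ioo hs0 hs hns
  have hnhds : ∀ᶠ s' in 𝓝 s, s' ∈ Ioo (D.t j) (D.t (j + 1)) := Ioo_mem_nhds hj.1 hj.2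
  rcases lt_trichotomy j k with hjk | rfl | hkj
  · -- `s < t_{j+1} ≤ t_k`: mode `k` is in its `pre` phase
    cases k with
    | zero => exact absurd hjk (Nat.not_lt_zero _)
    | succ m =>
      rcases (Nat.lt_succ_iff.1 hjk).eq_or_lt with rfl | hjm
      · -- receiving phase
        have hev : D.X (j + 1) =ᶠ[𝓝 s] D.recv j :=
          hnhds.mono fun s' hs' => D.X_succ_of_mem ⟨hs'.1, hs'.2.le⟩
        refine ((D.hasDerivAt_recv hj).congr_of_eventuallyEq hev).congr_deriv ?_
        unfold truncRHS
        rw [D.indicator_prev hj, D.indicator_Ioo hj, D.X_succ_of_mem ⟨hj.1, hj.2.le⟩,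
          if_pos rfl, if_neg (Nat.succ_ne_self j)]
        simp only [prevMode, Nat.succ_ne_zero, if_false, Nat.add_sub_cancel,
          D.X_of_mem ⟨hj.1, hj.2.le⟩]
        have he : lam ^ (((n₀ + (j + 1) : ℕ) : ℝ) - 1) = lam ^ ((n₀ + j : ℕ) : ℝ) := by
          congr 1; push_cast; ring
        rw [he, scaleD]
        ring
      · -- zero phase
        have hle : D.t (j + 1) ≤ D.t m := D.t_strictMono.monotone (Nat.succ_le_of_lt hjm)
        have hev : D.X (m + 1) =ᶠ[𝓝 s] fun _ => (0 : ℝ) :=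
          hnhds.mono fun s' hs' => D.X_succ_of_le (hs'.2.le.trans hle)
        refine ((hasDerivAt_const s (0 : ℝ)).congr_of_eventuallyEq hev).congr_deriv ?_
        unfold truncRHS
        rw [D.indicator_prev hj, D.indicator_Ioo hj, D.X_succ_of_le (hj.2.le.trans hle),
          if_neg (by omega), if_neg (by omega)]
        ring
  · -- giving phase
    have hev : D.X j =ᶠ[𝓝 s] D.give j :=
      hnhds.mono fun s' hs' => D.X_of_mem ⟨hs'.1, hs'.2.le⟩
    refine ((D.hasDerivAt_give hj).congr_of_eventuallyEq hev).congr_deriv ?_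
    unfold truncRHS
    rw [D.indicator_prev hj, D.indicator_Ioo hj, D.X_of_mem ⟨hj.1, hj.2.le⟩,
      D.X_succ_of_mem ⟨hj.1, hj.2.le⟩, if_neg (Nat.succ_ne_self j).symm, if_pos rfl, scaleD]
    ring
  · -- decay phase
    have hlt : D.t (k + 1) < s := (D.t_strictMono.monotone (Nat.succ_le_of_lt hkj)).trans_lt hj.1
    have hev : D.X k =ᶠ[𝓝 s] D.decay k :=
      hnhds.mono fun s' hs' =>
        D.X_of_lt ((D.t_strictMono.monotone (Nat.succ_le_of_lt hkj)).trans_lt hs'.1)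
    refine ((D.hasDerivAt_decay k s).congr_of_eventuallyEq hev).congr_deriv ?_
    unfold truncRHS
    rw [D.indicator_prev hj, D.indicator_Ioo hj, D.X_of_lt hlt, if_neg (by omega),
      if_neg (by omega), scaleD]
    ring

/-! #### Blow-up of the weighted amplitudes -/

/-- Blow-up of the weighted amplitudes: `λ^{δ'(n₀+k)} X_{n₀+k}(t_{n₀+k}) = λ^{δ'n₀+(δ'-δ)k} → ∞`, and `t_k ↑ T_*`. [cite: Tao2016AveragedNS, §5.2 Prop. 5.1 ("In particular …")] -/
theorem blowup (δ' : ℝ) (hδ' : δ < δ') (M s₀ : ℝ) (hs₀ : s₀ < D.Tstar) :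
    ∃ s ∈ Ioo s₀ D.Tstar, ∃ k : ℕ, M < lam ^ (δ' * ((n₀ + k : ℕ) : ℝ)) * |D.X k s| := by
  have h1 : ∀ᶠ k in atTop, s₀ < D.t k := (tendsto_order.1 D.tendsto_t).1 s₀ hs₀
  have h2 : ∀ᶠ k : ℕ in atTop, M < lam ^ (δ' * ((n₀ + k : ℕ) : ℝ)) * scaleA lam δ k := by
    have hr : 1 < lam ^ (δ' - δ) := Real.one_lt_rpow D.one_lt (by linarith)
    have hC : 0 < lam ^ (δ' * n₀) := Real.rpow_pos_of_pos D.lam_pos _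
    have ht : Tendsto (fun k : ℕ => lam ^ (δ' * n₀) * (lam ^ (δ' - δ)) ^ k) atTop atTop :=
      (tendsto_pow_atTop_atTop_of_one_lt hr).const_mul_atTop hC
    have heq : ∀ k : ℕ, lam ^ (δ' * ((n₀ + k : ℕ) : ℝ)) * scaleA lam δ k =
        lam ^ (δ' * n₀) * (lam ^ (δ' - δ)) ^ k := by
      intro k
      rw [scaleA, ← Real.rpow_natCast, ← Real.rpow_mul D.lam_pos.le, ← Real.rpow_add D.lam_pos,
        ← Real.rpow_add D.lam_pos]
      congr 1; push_cast; ring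
    simpa only [← heq] using ht.eventually_gt_atTop M
  obtain ⟨k, hk1, hk2⟩ := (h1.and h2).exists
  refine ⟨D.t k, ⟨hk1, D.t_lt_Tstar k⟩, k, ?_⟩
  rwa [X_t, abs_of_pos (scaleA_pos D.one_lt k)]

end StepData

/-! ### Proof of Proposition 5.1 -/

/-- **Tao 2016, Proposition 5.1 (blow-up for the truncated dyadic model), proved**: discharges the
named fact `Tao2016_prop51`. [cite: Tao2016AveragedNS, §5.2 Prop. 5.1 and its proof, p. 26] -/
theorem Tao2016_prop51_holds : Tao2016_prop51 := by
  intro lam α δ hlam hα0 hα hδ0 hδ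
  have hlam0 : 0 < lam := by linarith
  -- the level `θ = λ^{-δ}` to be reached by each transfer
  have hθ0 : 0 < lam ^ (-δ) := Real.rpow_pos_of_pos hlam0 _
  have hθ1 : lam ^ (-δ) < 1 := Real.rpow_lt_one_of_one_lt_of_neg hlam (by linarith)
  obtain ⟨T, hT, η, hη, H⟩ := pumpGate_exists hθ0 hθ1
  -- choice of `n₀`: `λ^{2α} λ^{-(1-2α) n₀} ≤ η`
  obtain ⟨n₀, hn₀⟩ : ∃ n₀ : ℕ, lam ^ (2 * α) * (lam ^ (-(1 - 2 * α))) ^ n₀ ≤ η := by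
    have h2α : 0 < lam ^ (2 * α) := Real.rpow_pos_of_pos hlam0 _
    have hb1 : lam ^ (-(1 - 2 * α)) < 1 := Real.rpow_lt_one_of_one_lt_of_neg hlam (by linarith)
    obtain ⟨n, hn⟩ := exists_pow_lt_of_lt_one (div_pos hη h2α) hb1
    refine ⟨n, ?_⟩
    rw [lt_div_iff₀ h2α] at hn
    linarith
  -- the rescaled dissipation coefficients stay below the threshold `η`
  have hε : ∀ k : ℕ, 0 ≤ scaleD lam α n₀ k / scaleC lam δ n₀ k ∧
      scaleD lam α n₀ k / scaleC lam δ n₀ k ≤ η ∧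
      0 ≤ scaleD lam α n₀ (k + 1) / scaleC lam δ n₀ k ∧
      scaleD lam α n₀ (k + 1) / scaleC lam δ n₀ k ≤ η := by
    intro k
    have hc := scaleC_pos hlam k (δ := δ) (n₀ := n₀)
    have e1 : scaleD lam α n₀ k / scaleC lam δ n₀ k =
        lam ^ ((2 * α - 1) * n₀ + (2 * α - 1 + δ) * k) := by
      rw [div_eq_iff hc.ne']
      simp only [scaleD, scaleC, scaleA]
      rw [← Real.rpow_add hlam0, ← Real.rpow_add hlam0]
      congr 1; push_cast; ring
    have e2 : scaleD lam α n₀ (k + 1) / scaleC lam δ n₀ k =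
        lam ^ (2 * α) * (scaleD lam α n₀ k / scaleC lam δ n₀ k) := by
      rw [← mul_div_assoc]
      congr 1
      simp only [scaleD]
      rw [← Real.rpow_add hlam0]
      congr 1; push_cast; ring
    have hb : lam ^ ((2 * α - 1) * n₀ + (2 * α - 1 + δ) * k) ≤ (lam ^ (-(1 - 2 * α))) ^ n₀ := by
      rw [← Real.rpow_natCast, ← Real.rpow_mul hlam0.le]
      apply Real.rpow_le_rpow_of_exponent_le hlam.le
      have : (2 * α - 1 + δ) * k ≤ 0 :=
        mul_nonpos_of_nonpos_of_nonneg (by linarith) (Nat.cast_nonneg k)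
      linarith
    have h2α : 1 ≤ lam ^ (2 * α) := Real.one_le_rpow hlam.le (by linarith)
    have hq0 : 0 ≤ scaleD lam α n₀ k / scaleC lam δ n₀ k :=
      div_nonneg (scaleD_pos hlam k).le hc.le
    have hq' : scaleD lam α n₀ (k + 1) / scaleC lam δ n₀ k ≤ η := by
      rw [e2]
      calc lam ^ (2 * α) * (scaleD lam α n₀ k / scaleC lam δ n₀ k)
          ≤ lam ^ (2 * α) * (lam ^ (-(1 - 2 * α))) ^ n₀ := by
            rw [e1]; exact mul_le_mul_of_nonneg_left hb (by positivity)
        _ ≤ η := hn₀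
    have hqq : scaleD lam α n₀ k / scaleC lam δ n₀ k ≤
        scaleD lam α n₀ (k + 1) / scaleC lam δ n₀ k := by
      rw [e2]; exact le_mul_of_one_le_left hq0 h2α
    exact ⟨hq0, hqq.trans hq', hq0.trans hqq, hq'⟩
  choose U V τ hτpos hτle hU0 hV0 hVτ hUc hVc hode using
    fun k => H _ _ (hε k).1 (hε k).2.1 (hε k).2.2.1 (hε k).2.2.2
  let D : StepData lam α δ n₀ :=
    { T := T, U := U, V := V, τ := τ, one_lt := hlam, δ_lt_one := by linarith, τ_pos := hτpos,
      τ_le := hτle, U_zero := hU0, V_zero := hV0, V_τ := hVτ, U_cont := hUc, V_cont := hVc,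
      ode := hode }
  refine ⟨n₀, D.t, D.Tstar, D.X, D.t_zero, D.t_strictMono, D.t_lt_Tstar, D.tendsto_t,
    fun k => (D.continuous_X k).continuousOn, ?_, ?_, fun k => D.X_t k, D.blowup⟩
  · rintro k hk s - hs
    obtain ⟨m, rfl⟩ : ∃ m, k = m + 1 := Nat.exists_eq_succ_of_ne_zero (by omega)
    rw [Nat.add_sub_cancel] at hs
    exact D.X_succ_of_le hs
  · rintro k s ⟨hs0, hs⟩ hns
    exact D.hasDerivAt_X k hs0 hs hns


end TruncatedDyadic

/-- **The barrier `TruncatedDyadicBlowup` holds** (it is Tao's Prop. 5.1 by definition).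
[cite: Tao2016AveragedNS, §5.2 Prop. 5.1] -/
theorem TruncatedDyadicBlowup_holds : TruncatedDyadicBlowup :=
  TruncatedDyadic.Tao2016_prop51_holds

end Literature.Barriers.NavierStokesRegularity

/-! ## Appendix: the range `0 < δ ≤ 1 - 2α`, the endpoint, Type I rate and discrete self-similarity

Not in print (Tao states Prop. 5.1 for `δ < 1 - 2α`); added by the barrier audit of 2026-08-14. -/


namespace Literature.Barriers.NavierStokesRegularity

namespace TruncatedDyadic

namespace StepData

variable {lam α δ : ℝ} {n₀ : ℕ} (D : StepData lam α δ n₀)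

/-- Along each rescaled transfer the pump-gate energy `U² + V²` does not increase (its derivative is
`-2(d_k/c_k)U² - 2(d_{k+1}/c_k)V² ≤ 0`), so `U_k(s)² + V_k(s)² ≤ 1` on `[0, T]`. [cite: Tao2016AveragedNS, §5.1 (the pump gate preserves `x² + y²`) and §5.2 proof of Prop. 5.1] -/
lemma sq_add_sq_le_one (k : ℕ) {s : ℝ} (hs : s ∈ Icc 0 D.T) :
    D.U k s ^ 2 + D.V k s ^ 2 ≤ 1 := by
  set E : ℝ → ℝ := fun s => D.U k s * D.U k s + D.V k s * D.V k s with hE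
  have hcont : ContinuousOn E (Icc 0 D.T) :=
    (((D.U_cont k).mul (D.U_cont k)).add ((D.V_cont k).mul (D.V_cont k))).continuousOn
  have hder : ∀ x ∈ Ioo 0 D.T, HasDerivAt E
      (-(2 * (scaleD lam α n₀ k / scaleC lam δ n₀ k)) * D.U k x ^ 2
        - (2 * (scaleD lam α n₀ (k + 1) / scaleC lam δ n₀ k)) * D.V k x ^ 2) x := by
    intro x hx
    obtain ⟨hU, hV⟩ := D.ode k x hx
    exact ((hU.mul hU).add (hV.mul hV)).congr_deriv (by ring)
  have hint : interior (Icc 0 D.T) = Ioo 0 D.T := interior_Icc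
  have hanti : AntitoneOn E (Icc 0 D.T) := by
    apply antitoneOn_of_deriv_nonpos (convex_Icc 0 D.T) hcont
    · rw [hint]
      intro x hx
      exact (hder x hx).differentiableAt.differentiableWithinAt
    · rw [hint]
      intro x hx
      rw [(hder x hx).deriv]
      have h1 : 0 ≤ scaleD lam α n₀ k / scaleC lam δ n₀ k :=
        div_nonneg (scaleD_pos D.one_lt k).le (scaleC_pos D.one_lt k).le
      have h2 : 0 ≤ scaleD lam α n₀ (k + 1) / scaleC lam δ n₀ k :=
        div_nonneg (scaleD_pos D.one_lt (k + 1)).le (scaleC_pos D.one_lt k).le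
      nlinarith [sq_nonneg (D.U k x), sq_nonneg (D.V k x)]
  have h0 : E 0 = 1 := by simp [hE, D.U_zero, D.V_zero]
  have h := hanti ⟨le_rfl, D.τ_pos 0 |>.le.trans (D.τ_le 0)⟩ hs hs.1
  rw [h0] at h
  have : D.U k s ^ 2 + D.V k s ^ 2 = E s := by simp only [hE]; ring
  rw [this]
  exact h

/-- `|U_k(s)| ≤ 1` on `[0, T]`. [folklore] -/
lemma abs_U_le_one (k : ℕ) {s : ℝ} (hs : s ∈ Icc 0 D.T) : |D.U k s| ≤ 1 := by
  have h := D.sq_add_sq_le_one k hs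
  rw [← sq_le_one_iff_abs_le_one]
  nlinarith [sq_nonneg (D.V k s)]

/-- `|V_k(s)| ≤ 1` on `[0, T]`. [folklore] -/
lemma abs_V_le_one (k : ℕ) {s : ℝ} (hs : s ∈ Icc 0 D.T) : |D.V k s| ≤ 1 := by
  have h := D.sq_add_sq_le_one k hs
  rw [← sq_le_one_iff_abs_le_one]
  nlinarith [sq_nonneg (D.U k s)]

/-- The rescaled time of a point of `(t_k, t_{k+1}]` lies in `[0, T]`. [folklore] -/
lemma mem_Icc_rescaled {k : ℕ} {s : ℝ} (hs : s ∈ Ioc (D.t k) (D.t (k + 1))) :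
    scaleC lam δ n₀ k * (s - D.t k) ∈ Icc 0 D.T := by
  have hc := scaleC_pos D.one_lt k (δ := δ) (n₀ := n₀)
  constructor
  · exact mul_nonneg hc.le (by linarith [hs.1])
  · calc scaleC lam δ n₀ k * (s - D.t k) ≤ scaleC lam δ n₀ k * (D.t (k + 1) - D.t k) := by
          gcongr; exact hs.2
      _ = D.τ k := D.c_mul_sub k
      _ ≤ D.T := D.τ_le k

/-- `τ_k ∈ [0, T]`. [folklore] -/
lemma τ_mem_Icc (k : ℕ) : D.τ k ∈ Icc 0 D.T := ⟨(D.τ_pos k).le, D.τ_le k⟩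

/-- **Amplitude bound for the constructed modes**: `|X_{n₀+k}(s)| ≤ max(A_k, A_{k-1})` for all `s`
(receiving phase bounded by `A_{k-1}`, giving and decay phases by `A_k`, using `U² + V² ≤ 1`). [cite: Tao2016AveragedNS, §5.2 proof of Prop. 5.1] -/
lemma abs_X_le (k : ℕ) (s : ℝ) :
    |D.X k s| ≤ max (scaleA lam δ k) (scaleA lam δ (k - 1)) := by
  have hAk : 0 < scaleA lam δ k := scaleA_pos D.one_lt k
  by_cases h1 : s ≤ D.t k
  · -- `pre` phase
    simp only [X, if_pos h1]
    cases k with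
    | zero => simp [pre, scaleA_zero]
    | succ m =>
      simp only [pre, Nat.add_sub_cancel]
      split_ifs with h2
      · simp only [abs_zero]
        exact le_max_of_le_left hAk.le
      · rw [not_le] at h2
        apply le_max_of_le_right
        rw [recv, abs_mul, abs_of_pos (scaleA_pos D.one_lt m)]
        have hAm : 0 ≤ scaleA lam δ m := (scaleA_pos D.one_lt m).le
        have := D.abs_V_le_one m (D.mem_Icc_rescaled ⟨h2, h1⟩)
        calc scaleA lam δ m * |D.V m (scaleC lam δ n₀ m * (s - D.t m))|
            ≤ scaleA lam δ m * 1 := by gcongr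
          _ = scaleA lam δ m := mul_one _
  · rw [not_le] at h1
    apply le_max_of_le_left
    by_cases h2 : s ≤ D.t (k + 1)
    · -- giving phase
      rw [D.X_of_mem ⟨h1, h2⟩, give, abs_mul, abs_of_pos hAk]
      have := D.abs_U_le_one k (D.mem_Icc_rescaled ⟨h1, h2⟩)
      calc scaleA lam δ k * |D.U k (scaleC lam δ n₀ k * (s - D.t k))|
          ≤ scaleA lam δ k * 1 := by gcongr
        _ = scaleA lam δ k := mul_one _
    · -- decay phase
      rw [not_le] at h2
      rw [D.X_of_lt h2, decay, abs_mul, abs_mul, abs_of_pos hAk, Real.abs_exp]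
      have hU := D.abs_U_le_one k (D.τ_mem_Icc k)
      have hexp : Real.exp (-(scaleD lam α n₀ k * (s - D.t (k + 1)))) ≤ 1 := by
        rw [Real.exp_le_one_iff, neg_nonpos]
        exact mul_nonneg (scaleD_pos D.one_lt k).le (by linarith)
      calc scaleA lam δ k * |D.U k (D.τ k)| * Real.exp (-(scaleD lam α n₀ k * (s - D.t (k + 1))))
          ≤ scaleA lam δ k * 1 * 1 := by gcongr
        _ = scaleA lam δ k := by ring

end StepData

/-! ### The construction for `0 < δ ≤ 1 - 2α` (the endpoint included) -/

/-- **The iterative construction exists for every `0 < δ ≤ 1 - 2α`** — Tao's printed hypothesis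
`δ < 1 - 2α` is only used through `2α - 1 + δ ≤ 0` (the rescaled dissipations
`ε_k = λ^{-(1-2α)n₀ - (1-2α-δ)k}` are then non-increasing in `k`, and small for `n₀` large); at the
endpoint `δ = 1 - 2α` they are constant, `ε_k = λ^{-(1-2α)n₀}`, and the same perturbation argument
applies. [cite: Tao2016AveragedNS, §5.2 proof of Prop. 5.1 (p. 26)] -/
theorem exists_stepData {lam α δ : ℝ} (hlam : 1 < lam) (hα0 : 0 < α) (hα : α < 1 / 2)
    (hδ0 : 0 < δ) (hδ : δ ≤ 1 - 2 * α) : ∃ n₀ : ℕ, Nonempty (StepData lam α δ n₀) := by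
  have hlam0 : 0 < lam := by linarith
  have hθ0 : 0 < lam ^ (-δ) := Real.rpow_pos_of_pos hlam0 _
  have hθ1 : lam ^ (-δ) < 1 := Real.rpow_lt_one_of_one_lt_of_neg hlam (by linarith)
  obtain ⟨T, hT, η, hη, H⟩ := pumpGate_exists hθ0 hθ1
  obtain ⟨n₀, hn₀⟩ : ∃ n₀ : ℕ, lam ^ (2 * α) * (lam ^ (-(1 - 2 * α))) ^ n₀ ≤ η := by
    have h2α : 0 < lam ^ (2 * α) := Real.rpow_pos_of_pos hlam0 _
    have hb1 : lam ^ (-(1 - 2 * α)) < 1 := Real.rpow_lt_one_of_one_lt_of_neg hlam (by linarith)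
    obtain ⟨n, hn⟩ := exists_pow_lt_of_lt_one (div_pos hη h2α) hb1
    refine ⟨n, ?_⟩
    rw [lt_div_iff₀ h2α] at hn
    linarith
  have hε : ∀ k : ℕ, 0 ≤ scaleD lam α n₀ k / scaleC lam δ n₀ k ∧
      scaleD lam α n₀ k / scaleC lam δ n₀ k ≤ η ∧
      0 ≤ scaleD lam α n₀ (k + 1) / scaleC lam δ n₀ k ∧
      scaleD lam α n₀ (k + 1) / scaleC lam δ n₀ k ≤ η := by
    intro k
    have hc := scaleC_pos hlam k (δ := δ) (n₀ := n₀)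
    have e1 : scaleD lam α n₀ k / scaleC lam δ n₀ k =
        lam ^ ((2 * α - 1) * n₀ + (2 * α - 1 + δ) * k) := by
      rw [div_eq_iff hc.ne']
      simp only [scaleD, scaleC, scaleA]
      rw [← Real.rpow_add hlam0, ← Real.rpow_add hlam0]
      congr 1; push_cast; ring
    have e2 : scaleD lam α n₀ (k + 1) / scaleC lam δ n₀ k =
        lam ^ (2 * α) * (scaleD lam α n₀ k / scaleC lam δ n₀ k) := by
      rw [← mul_div_assoc]
      congr 1
      simp only [scaleD]
      rw [← Real.rpow_add hlam0]
      congr 1; push_cast; ring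
    have hb : lam ^ ((2 * α - 1) * n₀ + (2 * α - 1 + δ) * k) ≤ (lam ^ (-(1 - 2 * α))) ^ n₀ := by
      rw [← Real.rpow_natCast, ← Real.rpow_mul hlam0.le]
      apply Real.rpow_le_rpow_of_exponent_le hlam.le
      have : (2 * α - 1 + δ) * k ≤ 0 :=
        mul_nonpos_of_nonpos_of_nonneg (by linarith) (Nat.cast_nonneg k)
      linarith
    have h2α : 1 ≤ lam ^ (2 * α) := Real.one_le_rpow hlam.le (by linarith)
    have hq0 : 0 ≤ scaleD lam α n₀ k / scaleC lam δ n₀ k :=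
      div_nonneg (scaleD_pos hlam k).le hc.le
    have hq' : scaleD lam α n₀ (k + 1) / scaleC lam δ n₀ k ≤ η := by
      rw [e2]
      calc lam ^ (2 * α) * (scaleD lam α n₀ k / scaleC lam δ n₀ k)
          ≤ lam ^ (2 * α) * (lam ^ (-(1 - 2 * α))) ^ n₀ := by
            rw [e1]; exact mul_le_mul_of_nonneg_left hb (by positivity)
        _ ≤ η := hn₀
    have hqq : scaleD lam α n₀ k / scaleC lam δ n₀ k ≤
        scaleD lam α n₀ (k + 1) / scaleC lam δ n₀ k := by
      rw [e2]; exact le_mul_of_one_le_left hq0 h2α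
    exact ⟨hq0, hqq.trans hq', hq0.trans hqq, hq'⟩
  choose U V τ hτpos hτle hU0 hV0 hVτ hUc hVc hode using
    fun k => H _ _ (hε k).1 (hε k).2.1 (hε k).2.2.1 (hε k).2.2.2
  have hδ1 : δ < 1 := by linarith
  let D : StepData lam α δ n₀ :=
    { T := T, U := U, V := V, τ := τ, one_lt := hlam, δ_lt_one := hδ1, τ_pos := hτpos,
      τ_le := hτle, U_zero := hU0, V_zero := hV0, V_τ := hVτ, U_cont := hUc, V_cont := hVc,
      ode := hode }
  exact ⟨n₀, ⟨D⟩⟩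

/-- **Prop. 5.1 with the endpoint included**: the conclusion of `Tao2016_prop51` holds for every
`0 < δ ≤ 1 - 2α` (not only `δ < 1 - 2α`). [cite: Tao2016AveragedNS, §5.2 Prop. 5.1 and its proof, p. 26] -/
theorem Tao2016_prop51_of_le :
    ∀ lam α δ : ℝ, 1 < lam → 0 < α → α < 1 / 2 → 0 < δ → δ ≤ 1 - 2 * α →
    ∃ (n₀ : ℕ) (t : ℕ → ℝ) (Tstar : ℝ) (X : ℕ → ℝ → ℝ),
      t 0 = 0 ∧ StrictMono t ∧ (∀ k, t k < Tstar) ∧ Tendsto t atTop (𝓝 Tstar) ∧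
      (∀ k, ContinuousOn (X k) (Ico 0 Tstar)) ∧
      (∀ k, 1 ≤ k → ∀ s, 0 ≤ s → s ≤ t (k - 1) → X k s = 0) ∧
      (∀ k, ∀ s ∈ Ico 0 Tstar, s ∉ range t →
        HasDerivAt (X k) (truncRHS lam α n₀ t X k s) s) ∧
      (∀ k : ℕ, X k (t k) = lam ^ (-(δ * k))) ∧
      ∀ δ' : ℝ, δ < δ' → ∀ M s₀ : ℝ, s₀ < Tstar →
        ∃ s ∈ Ioo s₀ Tstar, ∃ k : ℕ, M < lam ^ (δ' * ((n₀ + k : ℕ) : ℝ)) * |X k s| := by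
  intro lam α δ hlam hα0 hα hδ0 hδ
  obtain ⟨n₀, ⟨D⟩⟩ := exists_stepData hlam hα0 hα hδ0 hδ
  refine ⟨n₀, D.t, D.Tstar, D.X, D.t_zero, D.t_strictMono, D.t_lt_Tstar, D.tendsto_t,
    fun k => (D.continuous_X k).continuousOn, ?_, ?_, fun k => D.X_t k, D.blowup⟩
  · rintro k hk s - hs
    obtain ⟨m, rfl⟩ : ∃ m, k = m + 1 := Nat.exists_eq_succ_of_ne_zero (by omega)
    rw [Nat.add_sub_cancel] at hs
    exact D.X_succ_of_le hs
  · rintro k s ⟨hs0, hs⟩ hns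
    exact D.hasDerivAt_X k hs0 hs hns

/-- **Prop. 5.1 at the endpoint `δ = 1 - 2α`, with the critical amplitude bound** (statement):
for `λ > 1` and `0 < α < 1/2` there are `n₀`, switching times `0 = t 0 < t 1 < … ↑ T_* < ∞` and
modes `X k` (continuous on `[0, T_*)`, `X k = 0` on `[0, t (k-1)]` for `k ≥ 1`) solving the
exogenously truncated system off the switching times, with `X k (t k) = λ^{-(1-2α)k}`, whose
CRITICAL weighted amplitude is bounded up to the blow-up time,
`λ^{(1-2α)(n₀+k)} |X k s| ≤ λ^{(1-2α)(n₀+1)}` for all `k`, `s`, while for every `δ' > 1 - 2α` the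
weight-`δ'` amplitudes are unbounded on every final interval `(s₀, T_*)`. Here `1 - 2α` is the
critical exponent of the dyadic scaling `Xₙ(t) ↦ λ^{(1-2α)m} X_{n+m}(λ^{-2αm}t)` leaving (xn)
invariant, so this is a blow-up at the scale-invariant ("Type I", discretely self-similar) rate.
Not stated in print — Tao takes `0 < δ < 1 - 2α`, but his proof uses only `2α - 1 + δ ≤ 0`;
proved below (`Tao2016_prop51_typeI`). [cite: Tao2016AveragedNS, §5.2 Prop. 5.1 and its proof (p. 26); §1.1 footnote p. 8 (Type I vs. Type II)] -/
def Tao2016_prop51_endpoint : Prop :=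
  ∀ lam α : ℝ, 1 < lam → 0 < α → α < 1 / 2 →
    ∃ (n₀ : ℕ) (t : ℕ → ℝ) (Tstar : ℝ) (X : ℕ → ℝ → ℝ),
      t 0 = 0 ∧ StrictMono t ∧ (∀ k, t k < Tstar) ∧ Tendsto t atTop (𝓝 Tstar) ∧
      (∀ k, ContinuousOn (X k) (Ico 0 Tstar)) ∧
      (∀ k, 1 ≤ k → ∀ s, 0 ≤ s → s ≤ t (k - 1) → X k s = 0) ∧
      (∀ k, ∀ s ∈ Ico 0 Tstar, s ∉ range t →
        HasDerivAt (X k) (truncRHS lam α n₀ t X k s) s) ∧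
      (∀ k : ℕ, X k (t k) = lam ^ (-((1 - 2 * α) * k))) ∧
      (∀ (k : ℕ) (s : ℝ), lam ^ ((1 - 2 * α) * ((n₀ + k : ℕ) : ℝ)) * |X k s| ≤
        lam ^ ((1 - 2 * α) * ((n₀ + 1 : ℕ) : ℝ))) ∧
      ∀ δ' : ℝ, 1 - 2 * α < δ' → ∀ M s₀ : ℝ, s₀ < Tstar →
        ∃ s ∈ Ioo s₀ Tstar, ∃ k : ℕ, M < lam ^ (δ' * ((n₀ + k : ℕ) : ℝ)) * |X k s|

/-- **Type I blow-up at the endpoint `δ = 1 - 2α`, proved**: discharges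
`Tao2016_prop51_endpoint` — the same construction run at the endpoint (`exists_stepData` with
`δ = 1 - 2α`), plus the amplitude bound `StepData.abs_X_le`. [cite: Tao2016AveragedNS, §5.2 Prop. 5.1 and its proof, p. 26] -/
theorem Tao2016_prop51_typeI : Tao2016_prop51_endpoint := by
  intro lam α hlam hα0 hα
  have hlam0 : 0 < lam := by linarith
  have hδ0 : 0 < 1 - 2 * α := by linarith
  obtain ⟨n₀, ⟨D⟩⟩ := exists_stepData hlam hα0 hα hδ0 le_rfl
  refine ⟨n₀, D.t, D.Tstar, D.X, D.t_zero, D.t_strictMono, D.t_lt_Tstar, D.tendsto_t,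
    fun k => (D.continuous_X k).continuousOn, ?_, ?_, fun k => D.X_t k, ?_, D.blowup⟩
  · rintro k hk s - hs
    obtain ⟨m, rfl⟩ : ∃ m, k = m + 1 := Nat.exists_eq_succ_of_ne_zero (by omega)
    rw [Nat.add_sub_cancel] at hs
    exact D.X_succ_of_le hs
  · rintro k s ⟨hs0, hs⟩ hns
    exact D.hasDerivAt_X k hs0 hs hns
  · intro k s
    generalize hδ : (1 : ℝ) - 2 * α = δ at D ⊢
    have hw : 0 < lam ^ (δ * ((n₀ + k : ℕ) : ℝ)) := Real.rpow_pos_of_pos hlam0 _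
    -- `λ^{δ(n₀+k)} A_k = λ^{δ n₀}` and `λ^{δ(n₀+k)} A_{k-1} ≤ λ^{δ(n₀+1)}`
    have hA : ∀ j : ℕ, j ≤ k → k ≤ j + 1 →
        lam ^ (δ * ((n₀ + k : ℕ) : ℝ)) * scaleA lam δ j ≤ lam ^ (δ * ((n₀ + 1 : ℕ) : ℝ)) := by
      intro j hj hj'
      rw [scaleA, ← Real.rpow_add hlam0]
      apply Real.rpow_le_rpow_of_exponent_le hlam.le
      have hj1 : (k : ℝ) ≤ j + 1 := by exact_mod_cast hj'
      push_cast
      nlinarith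
    have hb := D.abs_X_le k s
    calc lam ^ (δ * ((n₀ + k : ℕ) : ℝ)) * |D.X k s|
        ≤ lam ^ (δ * ((n₀ + k : ℕ) : ℝ)) * max (scaleA lam δ k) (scaleA lam δ (k - 1)) := by
          gcongr
      _ = max (lam ^ (δ * ((n₀ + k : ℕ) : ℝ)) * scaleA lam δ k)
            (lam ^ (δ * ((n₀ + k : ℕ) : ℝ)) * scaleA lam δ (k - 1)) := by
          rw [mul_max_of_nonneg _ _ hw.le]
      _ ≤ lam ^ (δ * ((n₀ + 1 : ℕ) : ℝ)) :=
          max_le (hA k le_rfl (Nat.le_succ k)) (hA (k - 1) (Nat.sub_le k 1) (by omega))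

/-! ### Scale relations at the endpoint `δ = 1 - 2α` -/

section endpoint

variable {lam α δ : ℝ} {n₀ : ℕ}

/-- `d_{k+1} = λ^{2α} d_k`. [folklore] -/
lemma scaleD_succ (h0 : 0 < lam) (k : ℕ) :
    scaleD lam α n₀ (k + 1) = lam ^ (2 * α) * scaleD lam α n₀ k := by
  simp only [scaleD]
  rw [← Real.rpow_add h0]
  congr 1; push_cast; ring

/-- At the endpoint `δ = 1 - 2α`: `c_{k+1} = λ^{2α} c_k` (the time scales contract by the factor
`λ^{-2α}` of the dyadic scaling). [folklore] -/
lemma scaleC_succ_endpoint (h0 : 0 < lam) (hδ : δ = 1 - 2 * α) (k : ℕ) :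
    scaleC lam δ n₀ (k + 1) = lam ^ (2 * α) * scaleC lam δ n₀ k := by
  simp only [scaleC, scaleA]
  rw [← Real.rpow_add h0, ← Real.rpow_add h0, ← Real.rpow_add h0]
  congr 1; push_cast; rw [hδ]; ring

/-- At the endpoint `δ = 1 - 2α` the rescaled dissipations `d_k / c_k` do not depend on `k`. [cite: Tao2016AveragedNS, §5.2 proof of Prop. 5.1 (the formula for `ε`)] -/
lemma scaleD_div_scaleC_endpoint (h1 : 1 < lam) (hδ : δ = 1 - 2 * α) (k : ℕ) :
    scaleD lam α n₀ k / scaleC lam δ n₀ k = scaleD lam α n₀ 0 / scaleC lam δ n₀ 0 := by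
  have h0 : 0 < lam := by linarith
  induction k with
  | zero => rfl
  | succ m ih =>
    rw [scaleD_succ h0, scaleC_succ_endpoint h0 hδ, mul_div_mul_left _ _ (Real.rpow_pos_of_pos h0 _).ne', ih]

end endpoint

namespace StepData

variable {lam α δ : ℝ} {n₀ : ℕ} (D : StepData lam α δ n₀)

/-- At the endpoint, with a common rescaled duration `τ_k = τ_0`, consecutive transfers contract by
`λ^{-2α}`: `Δ_k = λ^{2α} Δ_{k+1}`. [folklore] -/
lemma Δ_eq_mul_Δ_succ (hδ : δ = 1 - 2 * α) (hτ : ∀ k, D.τ k = D.τ 0) (k : ℕ) :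
    D.Δ k = lam ^ (2 * α) * D.Δ (k + 1) := by
  have hc := (scaleC_pos D.one_lt k (δ := δ) (n₀ := n₀)).ne'
  have hL := (Real.rpow_pos_of_pos D.lam_pos (2 * α)).ne'
  rw [Δ, Δ, hτ k, hτ (k + 1), scaleC_succ_endpoint D.lam_pos hδ]
  field_simp

/-- **Discrete self-similarity of the endpoint witness.** If `δ = 1 - 2α` and the per-step pump-gate
data are the same for every step (as they can be chosen, the rescaled dissipations being constant in
`k`), then from the second mode on each mode is an exact rescaled copy of the previous one:
`X_{k+1}(t_{k+1} + σ) = λ^{-(1-2α)} X_k(t_k + λ^{2α}σ)` for all `k ≥ 1` and all real `σ` — the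
dyadic scaling `Xₙ(t) ↦ λ^{(1-2α)}X_{n+1}(λ^{-2α}t)` maps the solution to a time-translate of itself. [folklore] -/
theorem dss (hδ : δ = 1 - 2 * α) (hU : ∀ k, D.U k = D.U 0) (hV : ∀ k, D.V k = D.V 0)
    (hτ : ∀ k, D.τ k = D.τ 0) {k : ℕ} (hk : 1 ≤ k) (σ : ℝ) :
    D.X (k + 1) (D.t (k + 1) + σ) = lam ^ (-δ) * D.X k (D.t k + lam ^ (2 * α) * σ) := by
  obtain ⟨m, rfl⟩ : ∃ m, k = m + 1 := Nat.exists_eq_succ_of_ne_zero (by omega)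
  have h0 := D.lam_pos
  set L : ℝ := lam ^ (2 * α) with hL
  have hLpos : 0 < L := Real.rpow_pos_of_pos h0 _
  have hΔ0 : D.Δ m = L * D.Δ (m + 1) := D.Δ_eq_mul_Δ_succ hδ hτ m
  have hΔ1 : D.Δ (m + 1) = L * D.Δ (m + 2) := D.Δ_eq_mul_Δ_succ hδ hτ (m + 1)
  have hc1 : scaleC lam δ n₀ (m + 2) = L * scaleC lam δ n₀ (m + 1) :=
    scaleC_succ_endpoint h0 hδ (m + 1)
  have hc0 : scaleC lam δ n₀ (m + 1) = L * scaleC lam δ n₀ m := scaleC_succ_endpoint h0 hδ m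
  have hd1 : scaleD lam α n₀ (m + 2) = L * scaleD lam α n₀ (m + 1) := scaleD_succ h0 (m + 1)
  have hA1 : scaleA lam δ (m + 2) = scaleA lam δ (m + 1) * lam ^ (-δ) := scaleA_succ D.one_lt _
  have hA0 : scaleA lam δ (m + 1) = scaleA lam δ m * lam ^ (-δ) := scaleA_succ D.one_lt _
  have ht2 : D.t (m + 2) = D.t (m + 1) + D.Δ (m + 1) := D.t_succ (m + 1)
  have ht3 : D.t (m + 3) = D.t (m + 2) + D.Δ (m + 2) := D.t_succ (m + 2)
  have ht1 : D.t (m + 1) = D.t m + D.Δ m := D.t_succ m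
  have hΔpos1 := D.Δ_pos (m + 1)
  have hΔpos2 := D.Δ_pos (m + 2)
  rcases le_or_gt σ (-D.Δ (m + 1)) with h1 | h1
  · -- both modes still vanish
    rw [D.X_succ_of_le (k := m + 1) (by linarith), D.X_succ_of_le (k := m) (by nlinarith), mul_zero]
  rcases le_or_gt σ 0 with h2 | h2
  · -- receiving phases
    rw [D.X_succ_of_mem (k := m + 1) ⟨by linarith, by linarith⟩,
      D.X_succ_of_mem (k := m) ⟨by nlinarith, by nlinarith⟩]
    simp only [recv]
    rw [hV (m + 1), hV m, hA0]
    have harg' : scaleC lam δ n₀ (m + 1) * (D.t (m + 2) + σ - D.t (m + 1)) =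
        scaleC lam δ n₀ m * (D.t (m + 1) + L * σ - D.t m) := by
      rw [ht2, ht1, hc0, hΔ0]; ring
    rw [harg']; ring
  rcases le_or_gt σ (D.Δ (m + 2)) with h3 | h3
  · -- giving phases
    rw [D.X_of_mem (k := m + 2) ⟨by linarith, by linarith⟩,
      D.X_of_mem (k := m + 1) ⟨by nlinarith, by nlinarith⟩]
    simp only [give]
    rw [hU (m + 2), hU (m + 1), hA1]
    have harg : scaleC lam δ n₀ (m + 2) * (D.t (m + 2) + σ - D.t (m + 2)) =
        scaleC lam δ n₀ (m + 1) * (D.t (m + 1) + L * σ - D.t (m + 1)) := by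
      rw [hc1]; ring
    rw [harg]; ring
  · -- decay phases
    rw [D.X_of_lt (k := m + 2) (by linarith), D.X_of_lt (k := m + 1) (by nlinarith)]
    simp only [decay]
    rw [hU (m + 2), hU (m + 1), hτ (m + 2), hτ (m + 1), hA1]
    have harg : scaleD lam α n₀ (m + 2) * (D.t (m + 2) + σ - D.t (m + 3)) =
        scaleD lam α n₀ (m + 1) * (D.t (m + 1) + L * σ - D.t (m + 2)) := by
      rw [ht3, ht2, hd1, hΔ1]; ring
    rw [harg]; ring

end StepData

/-- **The endpoint construction with identical steps.** For `λ > 1`, `0 < α < 1/2` and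
`δ = 1 - 2α` there are `n₀` and step data whose per-step pump-gate solutions `(U_k, V_k, τ_k)` do
not depend on `k` (one solution of the dissipative pump gate with the constant dissipations
`d_k/c_k = λ^{-(1-2α)n₀}`, `d_{k+1}/c_k = λ^{2α}λ^{-(1-2α)n₀}` serves every step). [cite: Tao2016AveragedNS, §5.2 proof of Prop. 5.1 (p. 26)] -/
theorem exists_stepData_const {lam α : ℝ} (hlam : 1 < lam) (hα0 : 0 < α) (hα : α < 1 / 2) :
    ∃ (n₀ : ℕ) (D : StepData lam α (1 - 2 * α) n₀),
      (∀ k, D.U k = D.U 0) ∧ (∀ k, D.V k = D.V 0) ∧ (∀ k, D.τ k = D.τ 0) := by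
  set δ : ℝ := 1 - 2 * α with hδ
  have hlam0 : 0 < lam := by linarith
  have hδ0 : 0 < δ := by rw [hδ]; linarith
  have hθ0 : 0 < lam ^ (-δ) := Real.rpow_pos_of_pos hlam0 _
  have hθ1 : lam ^ (-δ) < 1 := Real.rpow_lt_one_of_one_lt_of_neg hlam (by linarith)
  obtain ⟨T, hT, η, hη, H⟩ := pumpGate_exists hθ0 hθ1
  obtain ⟨n₀, hn₀⟩ : ∃ n₀ : ℕ, lam ^ (2 * α) * (lam ^ (-(1 - 2 * α))) ^ n₀ ≤ η := by
    have h2α : 0 < lam ^ (2 * α) := Real.rpow_pos_of_pos hlam0 _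
    have hb1 : lam ^ (-(1 - 2 * α)) < 1 := Real.rpow_lt_one_of_one_lt_of_neg hlam (by linarith)
    obtain ⟨n, hn⟩ := exists_pow_lt_of_lt_one (div_pos hη h2α) hb1
    refine ⟨n, ?_⟩
    rw [lt_div_iff₀ h2α] at hn
    linarith
  -- the two (constant) rescaled dissipations
  set ε : ℝ := scaleD lam α n₀ 0 / scaleC lam δ n₀ 0 with hε
  set ε' : ℝ := scaleD lam α n₀ 1 / scaleC lam δ n₀ 0 with hε'
  have hc := scaleC_pos hlam 0 (δ := δ) (n₀ := n₀)
  have e1 : ε = (lam ^ (-(1 - 2 * α))) ^ n₀ := by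
    rw [hε, div_eq_iff hc.ne', ← Real.rpow_natCast, ← Real.rpow_mul hlam0.le]
    simp only [scaleD, scaleC, scaleA]
    rw [← Real.rpow_add hlam0, ← Real.rpow_add hlam0]
    congr 1; push_cast; ring
  have e2 : ε' = lam ^ (2 * α) * ε := by
    rw [hε', hε, ← mul_div_assoc, scaleD_succ hlam0 0]
  have hε0 : 0 ≤ ε := div_nonneg (scaleD_pos hlam 0).le hc.le
  have h2α : 1 ≤ lam ^ (2 * α) := Real.one_le_rpow hlam.le (by linarith)
  have hε'η : ε' ≤ η := by rw [e2, e1]; exact hn₀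
  have hεε' : ε ≤ ε' := by rw [e2]; exact le_mul_of_one_le_left hε0 h2α
  obtain ⟨u, v, τ₁, hτpos, hτle, hu0, hv0, hvτ, huc, hvc, hode⟩ :=
    H ε ε' hε0 (hεε'.trans hε'η) (hε0.trans hεε') hε'η
  have hδ1 : δ < 1 := by rw [hδ]; linarith
  have hq : ∀ k : ℕ, scaleD lam α n₀ k / scaleC lam δ n₀ k = ε := fun k =>
    scaleD_div_scaleC_endpoint hlam rfl k
  have hq' : ∀ k : ℕ, scaleD lam α n₀ (k + 1) / scaleC lam δ n₀ k = ε' := by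
    intro k
    rw [scaleD_succ hlam0 k, mul_div_assoc, hq k, ← e2]
  let D : StepData lam α δ n₀ :=
    { T := T, U := fun _ => u, V := fun _ => v, τ := fun _ => τ₁, one_lt := hlam, δ_lt_one := hδ1,
      τ_pos := fun _ => hτpos, τ_le := fun _ => hτle, U_zero := fun _ => hu0, V_zero := fun _ => hv0,
      V_τ := fun _ => hvτ, U_cont := fun _ => huc, V_cont := fun _ => hvc,
      ode := fun k s hs => by rw [hq k, hq' k]; exact hode s hs }
  exact ⟨n₀, D, fun _ => rfl, fun _ => rfl, fun _ => rfl⟩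

/-- **Prop. 5.1 at the endpoint with an eventually discretely self-similar witness**: for `λ > 1`
and `0 < α < 1/2` there is a solution of the truncated system with all the properties recorded in
`Tao2016_prop51_endpoint` (switching values `X_k(t_k) = λ^{-(1-2α)k}`, bounded critical weighted
amplitude, blow-up of every weight `δ' > 1 - 2α`) which is moreover EXACTLY discretely
self-similar from the second mode on: `X_{k+1}(t_{k+1} + σ) = λ^{-(1-2α)} X_k(t_k + λ^{2α}σ)` for all
`k ≥ 1`, `σ ∈ ℝ` (for the witness, moreover, `t_{k+2} - t_{k+1} = λ^{-2α}(t_{k+1} - t_k)` for every `k` — `StepData.Δ_eq_mul_Δ_succ`; not a conjunct of the statement). Not in print. [cite: Tao2016AveragedNS, §5.2 Prop. 5.1 and its proof, p. 26] -/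
theorem Tao2016_prop51_dss :
    ∀ lam α : ℝ, 1 < lam → 0 < α → α < 1 / 2 →
    ∃ (n₀ : ℕ) (t : ℕ → ℝ) (Tstar : ℝ) (X : ℕ → ℝ → ℝ),
      t 0 = 0 ∧ StrictMono t ∧ (∀ k, t k < Tstar) ∧ Tendsto t atTop (𝓝 Tstar) ∧
      (∀ k, ContinuousOn (X k) (Ico 0 Tstar)) ∧
      (∀ k, 1 ≤ k → ∀ s, 0 ≤ s → s ≤ t (k - 1) → X k s = 0) ∧
      (∀ k, ∀ s ∈ Ico 0 Tstar, s ∉ range t →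
        HasDerivAt (X k) (truncRHS lam α n₀ t X k s) s) ∧
      (∀ k : ℕ, X k (t k) = lam ^ (-((1 - 2 * α) * k))) ∧
      (∀ (k : ℕ) (s : ℝ), lam ^ ((1 - 2 * α) * ((n₀ + k : ℕ) : ℝ)) * |X k s| ≤
        lam ^ ((1 - 2 * α) * ((n₀ + 1 : ℕ) : ℝ))) ∧
      (∀ k : ℕ, 1 ≤ k → ∀ σ : ℝ,
        X (k + 1) (t (k + 1) + σ) = lam ^ (-(1 - 2 * α)) * X k (t k + lam ^ (2 * α) * σ)) ∧
      ∀ δ' : ℝ, 1 - 2 * α < δ' → ∀ M s₀ : ℝ, s₀ < Tstar →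
        ∃ s ∈ Ioo s₀ Tstar, ∃ k : ℕ, M < lam ^ (δ' * ((n₀ + k : ℕ) : ℝ)) * |X k s| := by
  intro lam α hlam hα0 hα
  have hlam0 : 0 < lam := by linarith
  obtain ⟨n₀, D, hU, hV, hτ⟩ := exists_stepData_const hlam hα0 hα
  refine ⟨n₀, D.t, D.Tstar, D.X, D.t_zero, D.t_strictMono, D.t_lt_Tstar, D.tendsto_t,
    fun k => (D.continuous_X k).continuousOn, ?_, ?_, fun k => D.X_t k, ?_, ?_, D.blowup⟩
  · rintro k hk s - hs
    obtain ⟨m, rfl⟩ : ∃ m, k = m + 1 := Nat.exists_eq_succ_of_ne_zero (by omega)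
    rw [Nat.add_sub_cancel] at hs
    exact D.X_succ_of_le hs
  · rintro k s ⟨hs0, hs⟩ hns
    exact D.hasDerivAt_X k hs0 hs hns
  · intro k s
    generalize hδ : (1 : ℝ) - 2 * α = δ at D ⊢
    have hw : 0 < lam ^ (δ * ((n₀ + k : ℕ) : ℝ)) := Real.rpow_pos_of_pos hlam0 _
    have hA : ∀ j : ℕ, j ≤ k → k ≤ j + 1 →
        lam ^ (δ * ((n₀ + k : ℕ) : ℝ)) * scaleA lam δ j ≤ lam ^ (δ * ((n₀ + 1 : ℕ) : ℝ)) := by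
      intro j hj hj'
      rw [scaleA, ← Real.rpow_add hlam0]
      apply Real.rpow_le_rpow_of_exponent_le hlam.le
      have hj1 : (k : ℝ) ≤ j + 1 := by exact_mod_cast hj'
      have hδ0 : 0 < δ := by rw [← hδ]; linarith
      push_cast
      nlinarith
    have hb := D.abs_X_le k s
    calc lam ^ (δ * ((n₀ + k : ℕ) : ℝ)) * |D.X k s|
        ≤ lam ^ (δ * ((n₀ + k : ℕ) : ℝ)) * max (scaleA lam δ k) (scaleA lam δ (k - 1)) := by
          gcongr
      _ = max (lam ^ (δ * ((n₀ + k : ℕ) : ℝ)) * scaleA lam δ k)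
            (lam ^ (δ * ((n₀ + k : ℕ) : ℝ)) * scaleA lam δ (k - 1)) := by
          rw [mul_max_of_nonneg _ _ hw.le]
      _ ≤ lam ^ (δ * ((n₀ + 1 : ℕ) : ℝ)) :=
          max_le (hA k le_rfl (Nat.le_succ k)) (hA (k - 1) (Nat.sub_le k 1) (by omega))
  · intro k hk σ
    exact D.dss rfl hU hV hτ hk σ

end TruncatedDyadic

/-- **Barrier facet (Tao 2016, Prop. 5.1 run at the endpoint `δ = 1 - 2α`): the exogenously
truncated dyadic cascade also blows up at the scale-invariant (Type I, discretely self-similar)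
rate, with bounded critical weighted amplitude, for every supercritical `α < 1/2`.**
Definitionally `TruncatedDyadic.Tao2016_prop51_endpoint`; proved below
(`TruncatedDyadicTypeIBlowup_holds`). Companion of `TruncatedDyadicBlowup` (same model, same
technique class), recording what the printed range `δ < 1 - 2α` hides: Tao's Thm. 1.5 / Prop. 5.1
witnesses are of Type II ("critical norms of the solution diverge", so that results which "rule out
'Type I' blowup, in which a certain critical norm stays bounded" are not in contradiction with them,
and "it is not obvious to the author whether the main results in [ess] extend to averaged
Navier–Stokes equations" [cite: Tao2016AveragedNS, §1.1 p. 8 and footnote]); at the endpoint the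
same exogenous mechanism gives a critically bounded blow-up, and with identical steps (one pump-gate
solution for every step, `TruncatedDyadic.exists_stepData_const`) the witness is exactly discretely
self-similar from the second mode on (`TruncatedDyadic.Tao2016_prop51_dss`, a strengthening of the
facet's statement proved alongside it).
[cite: Tao2016AveragedNS, §5.2 Prop. 5.1 and proof p. 26] [cite: Tao2016AveragedNS, §1.2 p. 10]

BARRIER (structured block, D-0021):
- technique_class: energy-identity, energy-methods, function-space-estimates, harmonic-analysis, time-dependent-nonlinearity-insensitive, exogenously-truncated-dyadic-model, type-I-exclusion, self-similar-rate-exclusion, discretely-self-similar-blowup-exclusion, sup-type-critical-norm-regularity-criterion, type-I-blowup-rate, self-similar-rate-singularity, bounded-critical-norm-singularity, type-I-critical-norm-blowup (the last four are the catalogue's scenario tokens of `AxisymmetricTypeIExclusion` / `CriticalNormBlowupNecessity`, listed so that routes addressing those entries are matched here too) — the class of `TruncatedDyadicBlowup` (energy-identity-plus-estimates arguments insensitive to averaging of the nonlinearity AND to its (discontinuous) time-dependence [cite: Tao2016AveragedNS, §1.2 p. 10 and footnote]) when aimed not at full regularity but at the weaker targets "no blow-up at the scale-invariant rate / no (eventually)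 discretely self-similar blow-up / regularity under a bounded sup-type critical norm"
- blocks: for NavierStokesRegularity (regularity side), proofs BY SUCH ARGUMENTS of (a) the exclusion of forward singularities forming at the Type-I (scale-invariant) rate — including eventually EXACTLY discretely self-similar ones (`TruncatedDyadic.Tao2016_prop51_dss`: `X_{k+1}(t_{k+1}+σ) = λ^{-(1-2α)}X_k(t_k+λ^{2α}σ)` for `k ≥ 1`) — and (b) regularity criteria under a bounded `ℓ^∞`-in-scale critical quantity (the model analogue of `L^∞_t Ḃ^{-1+3/p}_{p,∞}`, e.g. `Ḃ^{1/2}_{2,∞}` at `α = 2/5` via `λⁿ ↔ N^{5/2}`, cf. `TruncatedDyadicBlowup.critical_blowup`) — through the same "weak version of Theorem 1.5" with `B̃ = B̃(t)` piecewise constant in time as for `TruncatedDyadicBlowup` [cite: Tao2016AveragedNS, §1.2 p. 10; §5.2 p. 26 (after the proof)]; it thereby localises where the known NS results of this shape must use more than that class (see evasions)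
- because: `TruncatedDyadic.Tao2016_prop51_typeI` (this file, axioms `propext`/`Classical.choice`/`Quot.sound`): Tao's iterative pump-gate construction needs only `2α - 1 + δ ≤ 0` (rescaled dissipations `ε_k = λ^{-(1-2α)n₀-(1-2α-δ)k} ≤ λ^{2α}λ^{-(1-2α)n₀} ≤ η`), so it runs at `δ = 1 - 2α`, where `ε_k` is constant; the pump-gate energy `U² + V²` is non-increasing (`StepData.sq_add_sq_le_one`), whence `|X_{n₀+k}(s)| ≤ max(A_k, A_{k-1})` with `A_k = λ^{-(1-2α)k}` (`StepData.abs_X_le`) and `sup_{k,s} λ^{(1-2α)(n₀+k)}|X_k(s)| ≤ λ^{(1-2α)(n₀+1)}`, while `λ^{δ'(n₀+k)} X_{n₀+k}(t_{n₀+k}) = λ^{δ'n₀+(δ'-(1-2α))k} → ∞` for `δ' > 1 - 2α`; choosing ONE pump-gate solution for all steps (`TruncatedDyadic.exists_stepData_const`, possible because `d_k/c_k` and `d_{k+1}/c_k` are constant in `k`), the relations `c_{k+1} = λ^{2α}c_k`, `d_{k+1} = λ^{2α}d_k`, `A_{k+1} = λ^{-(1-2α)}A_k` give the exact discrete self-similarity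 phase by phase (`StepData.dss`, `TruncatedDyadic.Tao2016_prop51_dss`) [cite: Tao2016AveragedNS, §5.2 proof of Prop. 5.1, p. 26]
- evasions_known: every known NS theorem of the blocked shapes uses fine structure or autonomy, consistently with this facet: `L^∞_t L³_x` regularity and `‖u(t)‖_{L³} → ∞` via backward uniqueness for the vorticity equation [cite: EscauriazaSereginSverak2003, Thms. 1.3–1.4] [cite: Tao2016AveragedNS, §1.1 p. 8] (moreover NOT even formally addressed here: in the dictionary of §1.2 p. 9 the witness keeps an amplitude `≍ A_j` at every abandoned scale `j`, so its `ℓ^q`-in-scale critical norms, `q < ∞` — the analogues of `L³ ⊃ Ḃ^{0}_{3,3}…`, `Ḃ^{-1+3/p}_{p,q}` — grow like `k^{1/q}` near `T_*`; only the `q = ∞` one stays bounded, in line with the printed necessity of `L³`- and `Ḃ^{-1+3/p}_{p,q}`-blow-up for `q < ∞` (catalogue `CriticalNormBlowupNecessity`)); axisymmetric Type-I exclusion via Liouville theorems resting on the maximum principle for the swirl (catalogue `AxisymmetricTypeIExclusion`); exact/discrete self-similar exclusions via the local energy inequality and the pressure (catalogue `LeraySelfSimilarBlowupExclusion`); any rescaling-compactness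 argument whose limit equation must be AUTONOMOUS evades the time-dependent model but then faces `TaoAveragedBlowup`, whose witness is Type II — so whether averaging-insensitive but autonomy-using arguments can exclude Type I blow-up stays open [cite: Tao2016AveragedNS, §1.1 footnote p. 8]
- scope_caveats: (i) what is established (here, in Lean) is the ODE statement; the PDE-level reading goes through the exogenous version of Thm. 1.5, only sketched in print ("We leave the details … to the interested reader") [cite: Tao2016AveragedNS, §5.2 p. 26]; (ii) "Type I" means the bounded `ℓ^∞`-in-scale critical amplitude `sup_k λ^{(1-2α)(n₀+k)}|X_k(s)|` (and, informally, at `α = 2/5` in the §1.2 dictionary `u ≈ Σ Xₙ λ^{3n/5}ψ(λ^{2n/5}x)`, the rate `‖u(t)‖²_∞ (T_*-t) ≍ λ^{n₀/5}` along the construction); `ℓ^q`-type critical norms with `q < ∞` of this witness are NOT bounded (previous item), and nothing pointwise-in-`x` is modelled; the discrete self-similarity of `Tao2016_prop51_dss` holds from the second mode on (`k ≥ 1`; the first mode carries the datum `X_{n₀}(0) = 1` instead of a receiving phase) and concerns a FORWARD solution on `[0, T_*)`: no ANCIENT critically bounded solution is constructed here, so Liouville theorems for such solutions are NOT shown to fail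 in the class (the constant-step chain plausibly extends to all `k ∈ ℤ`, with infinite energy in the low modes — a separate item), and the usual route "Liouville ⇒ no Type I" via rescaling/compactness needs an autonomous limit equation anyway (see evasions); (iii) one initial configuration (`X_{n₀}(0) = 1`), `n₀` large, i.e. critical size `λ^{(1-2α)n₀} ≫ 1` — small critical data stay global in the model too; (iv) the endpoint statement is not printed by Tao (who takes `δ < 1 - 2α`); it is this catalogue's machine-checked reading of his proof; (v) blow-up side: no bearing — exogenous control is not available for (xn) or NS (catalogue `DyadicCascadeRegularity`)
- status: established -/
def TruncatedDyadicTypeIBlowup : Prop :=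
  TruncatedDyadic.Tao2016_prop51_endpoint


/-- The facet is `TruncatedDyadic.Tao2016_prop51_endpoint`, by definition. [cite: Tao2016AveragedNS, §5.2 Prop. 5.1] -/
theorem truncatedDyadicTypeIBlowup_iff :
    TruncatedDyadicTypeIBlowup ↔ TruncatedDyadic.Tao2016_prop51_endpoint :=
  Iff.rfl

/-- **The facet `TruncatedDyadicTypeIBlowup` holds** (Lean proof: `Tao2016_prop51_typeI`).
[cite: Tao2016AveragedNS, §5.2 Prop. 5.1 and its proof, p. 26] -/
theorem TruncatedDyadicTypeIBlowup_holds : TruncatedDyadicTypeIBlowup :=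
  TruncatedDyadic.Tao2016_prop51_typeI

/-- Consequence at the three-dimensional value `α = 2/5`: a blow-up of the truncated model with
`X_{n₀+k}(t_{n₀+k}) = λ^{-k/5}`, critical weighted amplitude `λ^{(n₀+k)/5}|X_k(s)| ≤ λ^{(n₀+1)/5}`
throughout, and unbounded weight-`δ'` amplitudes for every `δ' > 1/5`. [cite: Tao2016AveragedNS, §5.2 Prop. 5.1 and the remark after it] -/
theorem TruncatedDyadicTypeIBlowup.at_two_fifths (h : TruncatedDyadicTypeIBlowup) {lam : ℝ}
    (hlam : 1 < lam) :
    ∃ (n₀ : ℕ) (t : ℕ → ℝ) (Tstar : ℝ) (X : ℕ → ℝ → ℝ),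
      t 0 = 0 ∧ StrictMono t ∧ (∀ k, t k < Tstar) ∧ Tendsto t atTop (𝓝 Tstar) ∧
      (∀ k : ℕ, X k (t k) = lam ^ (-((1 / 5 : ℝ) * k))) ∧
      (∀ (k : ℕ) (s : ℝ), lam ^ ((1 / 5 : ℝ) * ((n₀ + k : ℕ) : ℝ)) * |X k s| ≤
        lam ^ ((1 / 5 : ℝ) * ((n₀ + 1 : ℕ) : ℝ))) ∧
      ∀ δ' : ℝ, 1 / 5 < δ' → ∀ M s₀ : ℝ, s₀ < Tstar →
        ∃ s ∈ Ioo s₀ Tstar, ∃ k : ℕ, M < lam ^ (δ' * ((n₀ + k : ℕ) : ℝ)) * |X k s| := by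
  obtain ⟨n₀, t, Tstar, X, h0, hmono, hlt, hlim, -, -, -, hval, hcrit, hblow⟩ :=
    h lam (2 / 5) hlam (by norm_num) (by norm_num)
  refine ⟨n₀, t, Tstar, X, h0, hmono, hlt, hlim, ?_, ?_, ?_⟩
  · intro k; rw [hval k]; norm_num
  · intro k s; have := hcrit k s; norm_num at this ⊢; exact this
  · intro δ' hδ'; exact hblow δ' (by norm_num; exact hδ')

end Literature.Barriers.NavierStokesRegularity

namespace Literature.Barriers.NavierStokesRegularity.TruncatedDyadic

/-- **`Tao2016_prop51_endpoint` is a theorem of the tree (audit alias).** The named fact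
`Tao2016_prop51_endpoint` (`TruncatedDyadicBlowupProofs.lean`): Prop. 5.1 at the endpoint `δ =
1 - 2α`, with the critical amplitude bound (statement): … — is proved outright by
`Tao2016_prop51_typeI` (this file); this alias records the discharge under the census/audit
name `Tao2016_prop51_endpoint_holds` (librarian sweep g25, pass 5c; no new mathematics).
[cite: Tao2016AveragedNS, §5.2 Prop. 5.1 and its proof (p. 26); §1.1 footnote p. 8 (Type I vs. Type II)] -/
theorem Tao2016_prop51_endpoint_holds :
    Tao2016_prop51_endpoint :=
  Tao2016_prop51_typeI

end Literature.Barriers.NavierStokesRegularity.TruncatedDyadic
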